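import Summits.Langlands.Langlands.Theorems.IrreducibilityBySelfDualityReciprocityUpToIrreducibility
import Literature.NumberTheory.Automorphic.IsAutomorphicAE
import Literature.NumberTheory.Automorphic.PairLFunctionPolesRepData
import Summits.Langlands.Langlands.Theorems.IrreducibilityBySelfDualityReciprocityUpToIrreducibilityDeRhamBlocks
import Summits.Langlands.Langlands.Theorems.IrreducibilityBySelfDualityReciprocityUpToIrreducibilityGeometricConstituents
import Summits.Langlands.Langlands.Theorems.IrreducibilityBySelfDualityReciprocityUpToIrreducibilityIsobaricRigidity
import Summits.Langlands.Langlands.Theorems.IrreducibilityBySelfDualityReciprocityUpToIrreducibilityWeakAutomorphyOfFontaineMazur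
import Summits.Langlands.Langlands.Theorems.IrreducibilityBySelfDualityIrreducibleOffSectorTransfer
import Summits.Langlands.Langlands.Theorems.IrreducibilityBySelfDualityReciprocityUpToIrreducibilityCorrespondsConj
import Summits.Langlands.Langlands.Theorems.IrreducibilityBySelfDualityReciprocityUpToIrreducibilityTightness
import Summits.Langlands.Langlands.Theorems.IrreducibilityBySelfDualityReciprocityUpToIrreducibilityTightnessFM
import Summits.Langlands.Langlands.Theorems.IrreducibilityBySelfDualityReciprocityUpToIrreducibilityTightnessAbove
import Summits.Langlands.Langlands.Theorems.IrreducibilityBySelfDualityReciprocityUpToIrreducibilityAboveUnramified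
import Summits.Langlands.Langlands.Theorems.IrreducibilityBySelfDualityReciprocityUpToIrreducibilityAwayUnramified
import Summits.Langlands.Langlands.Theorems.IrreducibilityBySelfDualityReciprocityUpToIrreducibilityTrivialPairCorresponds
import Summits.Langlands.Langlands.Theorems.IrreducibilityBySelfDualityReciprocityUpToIrreducibilityRankOneMatching
import Summits.Langlands.Langlands.Theorems.IrreducibilityBySelfDualityReciprocityUpToIrreducibilityRankOneLocalComponent
import Summits.Langlands.Langlands.Theorems.IrreducibilityBySelfDualityReciprocityUpToIrreducibilityRankOneUnramified
import Summits.Langlands.Langlands.Theorems.ReciprocityUpToIrreducibility.Negative.TrivialCharacterLocalGlobal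
import Literature.NumberTheory.GaloisRepresentations.InertiaCharacter
import Literature.NumberTheory.Automorphic.LocalLanglandsGLOne
import Summits.Langlands.Langlands.Theorems.IrreducibilityBySelfDualityVarmaWeilTracesUnramified
import Summits.Langlands.Langlands.Theorems.IrreducibilityBySelfDualityReciprocityUpToIrreducibilityUnramifiedMatching
import Summits.Langlands.Langlands.Theorems.IrreducibilityBySelfDualityReciprocityUpToIrreducibilityHilbertSector
import Summits.Langlands.Langlands.Theorems.IrreducibilityBySelfDualityReciprocityUpToIrreducibilityUnramifiedMatchingConverse
import Summits.Langlands.Langlands.Theorems.IrreducibilityBySelfDualityReciprocityUpToIrreducibilityRankTwoConverseAbove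
import Summits.Langlands.Langlands.Theorems.IrreducibilityBySelfDualityReciprocityUpToIrreducibilityUnramifiedMatchingGLn
import Summits.Langlands.Langlands.Theorems.IrreducibilityBySelfDualityReciprocityUpToIrreducibilityLadicFiniteInertia
import Summits.Langlands.Langlands.Theorems.IrreducibilityBySelfDualityReciprocityUpToIrreducibilityLadicFiniteInertiaConverse
import Summits.Langlands.Langlands.Theorems.IrreducibilityBySelfDualityReciprocityUpToIrreducibilityRankOneMatchingRamified
import Summits.Langlands.Langlands.Theorems.IrreducibilityBySelfDualityReciprocityUpToIrreducibilityRankOneMatchingConverse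
import Summits.Langlands.Langlands.Theorems.IrreducibilityBySelfDualityReciprocityUpToIrreducibilityGLOneLocalComponentUnique
import Summits.Langlands.Langlands.Theorems.IrreducibilityBySelfDualityReciprocityUpToIrreducibilityRamifiedPlaces
import Summits.Langlands.Langlands.Theorems.IrreducibilityBySelfDualityReciprocityUpToIrreducibilityRankOneAllPlaces
import Summits.Langlands.Langlands.Theorems.IrreducibilityBySelfDualityReciprocityUpToIrreducibilityArtinLocalGlobal
import Literature.NumberTheory.Automorphic.PairLFunctionPolesRepDataOfHumphriesJo
import Summits.Langlands.Langlands.Theorems.IrreducibilityBySelfDualityReciprocityUpToIrreducibilityWeakExistenceNormTwist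
import Summits.Langlands.Langlands.Theorems.IrreducibilityBySelfDualityReciprocityUpToIrreducibilityRankOneFullSector
import Summits.Langlands.Langlands.Theorems.IrreducibilityBySelfDualityReciprocityUpToIrreducibilityWeakExistenceAll
import Summits.Langlands.Langlands.Theorems.IrreducibilityBySelfDualityReciprocityUpToIrreducibilityCruxDecidesWD
import Summits.Langlands.Langlands.Theorems.IrreducibilityBySelfDualityReciprocityUpToIrreducibilityHeckeTypeZeroFiniteOrder
import Literature.NumberTheory.PAdicHodge.FontaineDpstUnconditional
import Literature.NumberTheory.GaloisRepresentations.WeilLAdicCharacterProofs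
import Literature.NumberTheory.GaloisRepresentations.AlgebraicHeckeCharacterPurity
import Literature.NumberTheory.GaloisRepresentations.HeckeCharacterAutConj
import Literature.NumberTheory.Automorphic.ReciprocityGLnRankOneProofs
import Literature.NumberTheory.Automorphic.AutomorphicRepsGLOneHeckeCharacter
import Literature.NumberTheory.Automorphic.AlgebraicityParityGL
import Literature.FieldTheory.AlgClosed.AutomorphismExtension
import Literature.NumberTheory.GaloisRepresentations.WeakAbelianDirectSummand

/-!
# SKELETON (line `Sketch`, leads prover-line-stmt-Langlands-14328-0 → continuation c1
prover-line-stmt-Langlands-14328-c1-0 → c2 → c3 → c4 → c5 → c6 prover-line-stmt-Langlands-14328-c6-0) for the crux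
`ReciprocityUpToIrreducibility` (item stmt-Langlands-14328, route IrreducibilityBySelfDuality)

Owned copy of the checked line `Sketch` (crux-ideate r1 k=2, cards `isobaric-bootstrap` +
`one-prime-companions`).  Composition (kernel-checked, sorry-free glue):

  `ReciprocityUpToIrreducibility_of : ReciprocityUpToIrreducibility`
    from `stub_isobaricRigidity` (K4, Jacquet–Shalika II Thm 4.4 read at unramified places; LANDED,
    CONDITIONAL on the two named facts `JacquetShalika1981_partialPairL_{boundary,pole}_repData`
    which enter the composition as the route input `PairLBoundaryJS` and the stub `stub_jsPole`),
    `stub_geometricConstituents` (P1 + Fontaine III 1.5.2; LANDED), `stub_weakExistence` (W, OPEN: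
    BG Conj. 3.2.2 weak form), `stub_fontaineMazurLanglandsGLn` (OPEN: the accepted Literature text
    lang.S03 `FontaineMazurLanglandsGLn` for every rank at the pinned family — from which B_w
    `weakAutomorphy_of_stubs` follows by the LANDED registered stub
    `stub_weakAutomorphy_of_fontaineMazurLanglandsGLn`, continuation cycle c1),
    `stub_pairCompatibilityAway` + `stub_pairCompatibilityAbove` (LGC, OPEN: Taylor Conj. 7 for
    irreducible pairs; reshaped in cycle 1 from the single `stub_pairCompatibility` on the disprover's
    stub-misstated; the `Above` half is formally blocked on `defn-FontainePstWeilDeligneData`).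

Reshapes: L1 (lead 0): `IsobaricRigidity` carries the guard `0 < n →` (the composition has
`hn : 0 < n`; protects against junk `GL_0` data).  c1 (continuation lead): B_w is no longer a bare
sorry — its sorry now sits on the NAMED conjecture text lang.S03 (`stub_fontaineMazurLanglandsGLn`),
exactly as `stub_jsPole` sits on the named fact AC (2.3); so the skeleton closes the crux modulo
{AC (2.2) route input, AC (2.3), lang.S03, W, LGC-away, LGC-above}.  By-products kept from the line
file: `langlands_of_reciprocityUpToIrreducibility` (E → Langlands from the two rigidity stubs) and
`weak_of_onePrime` (card 2).  Stubs are the ONLY sorries.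

c3 (continuation lead, after clause (F8) of `IsFontaineDatum` landed at 17:19Z): §1d records the
sectors of the open stubs that are NO LONGER formally blocked — the unramified-at-`v` sector of
`stub_pairCompatibilityAbove` (landed `…AboveUnramified.lean`, p121983: there the `v ∣ ℓ` clause is the
ℓ-blind Frobenius-class matching, and the disprover's witness pair `(π_𝟙, 1)` IS compatible above ℓ) and
the rank-one sector `χ₀‖·‖^k` of `stub_weakExistence` (landed `…WeakExistenceNormTwist.lean`, p124074,
registered stub `stub_weakExistence_rankOne_normTwist`: Tate twists of de Rham representations are de
Rham for the pinned datum, Literature `AdmissibleTwist` p122448 / `PstWeilDeligneTateTwist` p123036; not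
imported here yet — farm build pending at registration time).  The five stubs and the composition are
unchanged.

c4 (§1e–§1g): blocker B3 removed (abstract inertia character), `(π_𝟙, 1)` corresponds for every `Rec`,
rank one complete at the good places.  c5 (§1h–§1j): wave N4 — the rank-`n` unramified matching for
EVERY `Rec` (registered stubs H1–H4, all landed) assembled into `GL₂: SatakeFrobCompatibleAt ⇒
LocalGlobalCompatibleAt` for every `Rec` (GL_n modulo the Jacquet–Shalika unramified computation), and
wave 2 — direction (A) of the SUMMIT on the Hilbert-modular sector modulo three named facts (registered
stub `stub_hilbert_automorphicToGalois`, landed), and waves 3–4 (§1k) — the converse: at the unramified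
places the clause IS Satake–Frobenius compatibility (registered stubs C2, Cn, C2-above, all landed).  The
five open stubs and the composition are unchanged; they remain the ONLY sorries.

c6 (§1k imports c5's four converse stubs by name; §1l): wave N6' — the rank-`n` unramified matching
WITHOUT the Jacquet–Shalika named fact: the DIVISIBILITY `∏ (1 - a T) ∣ P` for the JPSS `L`-polynomial of
`(π_v, 1)` from ONE spherical test vector (Shintani corner torus sum, in the tree for `GL_n`) plus the
degree bound of clause (iii-L) replace `hasRSLFactor_of_isSatakeParameter_haar (n,1)`; registered stubs
S1 `stub_rsZeta_fin_one_eq_integral_corner`, S2 `stub_spherical_whittaker_corner`,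
S3 `stub_whittaker_corner_diagonal_comm`, S4 `stub_rsZeta_spherical_trivial_eq` (lead),
S7' `stub_recGL_unramified_of_dvd` — ALL LANDED (p129975, p130274, p130383, p130557, p130449) and imported by
name; assembly `…UnramifiedMatchingGLn.lean` (registered stub
`stub_rankN_localGlobalCompatibleAt_of_satakeFrobCompatibleAt`) + Literature re-homing
`Literature/NumberTheory/Automorphic/GLnUnramifiedLFactorDivisibility.lean` (p130896).  The five open stubs
and the composition are unchanged; they are again the ONLY sorries.

c7 (§1m): wave N7 — blocker B2 after the Artin pin (`IsLocalArtinMap` / `canonicalArtin`, Literature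
2026-08-16 21:36Z): the `v ∤ ℓ` clause on the FINITE-INERTIA sector in every rank (registered stubs
S-A `stub_isWeilDeligneOfLadic_ofRep_of_isContinuousRep`, S-D `stub_eq_ofRep_of_isWeilDeligneOfLadic_of_isContinuousRep`),
the rank-one matching at an arbitrary place and its converse (S-C `stub_rankOne_recGL_matching_of_forall`,
S-F `stub_rankOne_forall_of_hasFrobSemisimpleClass`), uniqueness of the `GL₁` local component at every
place (S-E `stub_glOne_localComponent_unique`); lead: at a RAMIFIED place of the Hecke character the clause
IS the compatibility of `Rec`'s Artin map with class field theory on the pair (landed p132954 `…RamifiedPlaces`,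
p133189 `…RankOneAllPlaces`, p134123 `…ArtinLocalGlobal` + Literature fact p134112 `ArtinCharacterLocalGlobal`).
RESHAPE (c7, end of cycle): `stub_jsPole` (AC (2.3) as a bare debt) is replaced by `stub_humphriesJo_three_le`
(the accepted Literature text `HumphriesJo2024_archRankinSelberg_testVector` in ranks `≥ 3`) from which AC (2.3)
is now a THEOREM of the tree (`jsPole_of_stubs` via `JacquetShalika1981_partialPairL_pole_repData_of_humphriesJo_three_le`;
cross-line evidence `jsPole-from-HJ.md` of the 14329 lead).  So the skeleton closes the crux modulo
{AC (2.2) route input, Humphries–Jo 2024 (ranks ≥ 3), lang.S03, W, LGC-away, LGC-above}: two published theorems /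
accepted texts and three open conjectures; the five stubs are again the ONLY sorries.

c8 (§1n, continuation lead prover-line-stmt-Langlands-14328-c8-0): wave N8 — the T0 debts of the ARTIN PIN behind
c7's rank-one sector at all places: registered stubs S1 `stub_isLocalArtinMap_unique` (the named fact
`IsLocalArtinMap.unique`, from the proved Lubin–Tate norm-group theorem) and S2 `stub_exists_isLocalArtinMap` (the
named fact `exists_isLocalArtinMap`: clause (b) for the tree's own theta-based Artin map), and the glue
`glOne_reciprocity_of_isCanonical` (§1m for every canonically normalised `Rec`, modulo {`FontaineDatumExists`,
`artinCharacter_localGlobalCompatible`} only).  The five open stubs and the composition are unchanged.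
-/

open scoped NumberField Classical Polynomial MatrixGroups
open Filter IsDedekindDomain Polynomial
open Literature.NumberTheory.Automorphic Literature.NumberTheory.GaloisRepresentations
open Literature.NumberTheory.PAdicHodge
open Summit.Langlands
open Summit.Langlands.Langlands.Theses.IrreducibilityBySelfDuality
open Summit.Langlands.Langlands.Theorems.IrreducibleGL3CM
open Summit.Langlands.Langlands.Theorems.ReciprocityUpToIrreducibility

noncomputable section
set_option linter.dupNamespace false

namespace Summit.Langlands.Langlands.Theorems.ReciprocityUpToIrreducibility

/-! ## 0. The L-normalised Satake–Frobenius dictionary is multiplicative (provable now) -/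

/-- `arithFrobPolyOfSatake ι q 1 (α + β) = (…α) * (…β)`: a direct sum of compatible Galois
representations corresponds to the UNION of Satake multisets. [folklore] -/
theorem arithFrobPolyOfSatake_add {ℓ : ℕ} [Fact ℓ.Prime] (ι : PadicAlgCl ℓ ≃+* ℂ) (q m : ℕ)
    (α β : Multiset ℂ) :
    arithFrobPolyOfSatake ι q m (α + β) =
      arithFrobPolyOfSatake ι q m α * arithFrobPolyOfSatake ι q m β := by
  simp [arithFrobPolyOfSatake, Multiset.map_add, Multiset.prod_add]

/-- … and over a finite family. [folklore] -/
theorem arithFrobPolyOfSatake_sum {ℓ : ℕ} [Fact ℓ.Prime] (ι : PadicAlgCl ℓ ≃+* ℂ) (q m : ℕ)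
    {k : ℕ} (β : Fin k → Multiset ℂ) :
    arithFrobPolyOfSatake ι q m (∑ i, β i) = ∏ i, arithFrobPolyOfSatake ι q m (β i) := by
  classical
  induction k with
  | zero => simp [arithFrobPolyOfSatake]
  | succ k ih =>
    rw [Fin.sum_univ_castSucc, Fin.prod_univ_castSucc, arithFrobPolyOfSatake_add, ih]

/-! ## 1. The decoupled statements (card `isobaric-bootstrap`) -/

/-- Geometric, in the summit's PINNED sense, written without a `ReciprocityData` argument
(`ReciprocityData.pst` ignores its argument): unramified a.e. and de Rham at every `v ∣ ℓ`
for Fontaine's pinned datum. -/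
def IsGeometricPinned {K : Type} [Field K] [NumberField K] {ℓ : ℕ} [Fact ℓ.Prime] {n : ℕ}
    (ρ : FramedGaloisRep K (PadicAlgCl ℓ) n) : Prop :=
  (∀ᶠ v : HeightOneSpectrum (𝓞 K) in cofinite, ρ.IsUnramifiedAt v) ∧
    ∀ (v : HeightOneSpectrum (𝓞 K)) (hv : ((ℓ : ℕ) : 𝓞 K) ∈ v.asIdeal),
      (Literature.NumberTheory.PAdicHodge.fontainePstAdicCompletion v ℓ hv).IsDeRhamFramed
        (ρ.toLocal v)

/-- Sanity: the pinned predicate IS the summit's `IsGeometricFramed Rec` for every `Rec`. -/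
theorem isGeometricFramed_iff {K : Type} [Field K] [NumberField K] (Rec : ReciprocityData K)
    {ℓ : ℕ} [Fact ℓ.Prime] {n : ℕ} (ρ : FramedGaloisRep K (PadicAlgCl ℓ) n) :
    IsGeometricFramed Rec ρ ↔ IsGeometricPinned ρ := Iff.rfl

/-- **W — weak existence (the datum-free core of direction (A)).**  Every L-algebraic cuspidal
`π` of `GL_n(𝔸_K)` has, for every `ℓ, ι`, SOME geometric `ρ` (no irreducibility, no local–global
compatibility, no uniqueness) attached at almost all places.  This is the printed shape of every
construction theorem (Deligne, HLTT Thm A, Scholze Cor. V.4.2 — plus de Rham-ness). -/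
def WeakExistence : Prop :=
  ∀ (K : Type) [Field K] [NumberField K] (n : ℕ) (hcpt : isCompact_glFiniteIntegralLevel n K),
    0 < n → ∀ π : CuspidalAutomorphicRepData n K hcpt, π.1.IsLAlgebraic →
      ∀ (ℓ : ℕ) [Fact ℓ.Prime] (ι : PadicAlgCl ℓ ≃+* ℂ),
        ∃ ρ : FramedGaloisRep K (PadicAlgCl ℓ) n, IsGeometricPinned ρ ∧
          ∀ᶠ v : HeightOneSpectrum (𝓞 K) in cofinite, SatakeFrobCompatibleAt ι π.1 ρ v

/-- **B_w — weak automorphy (Fontaine–Mazur–Langlands, almost-everywhere form).** -/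
def WeakAutomorphy : Prop :=
  ∀ (K : Type) [Field K] [NumberField K] (n : ℕ) (hcpt : isCompact_glFiniteIntegralLevel n K),
    0 < n → ∀ (ℓ : ℕ) [Fact ℓ.Prime] (ι : PadicAlgCl ℓ ≃+* ℂ) (ρ : FramedGaloisRep K (PadicAlgCl ℓ) n),
      ρ.toGaloisRep.IsIrreducible → IsGeometricPinned ρ →
        ∃ π : CuspidalAutomorphicRepData n K hcpt, π.1.IsLAlgebraic ∧
          ∀ᶠ v : HeightOneSpectrum (𝓞 K) in cofinite, SatakeFrobCompatibleAt ι π.1 ρ v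

/-- **LGC — local–global compatibility for irreducible pairs, proved ONCE** (the only statement
that mentions the reciprocity datum; `∃ Rec` lives here). -/
def PairCompatibility : Prop :=
  ∀ (K : Type) [Field K] [NumberField K], ∃ Rec : ReciprocityData K,
    ∀ (n : ℕ) (hcpt : isCompact_glFiniteIntegralLevel n K), 0 < n →
      ∀ (π : CuspidalAutomorphicRepData n K hcpt), π.1.IsLAlgebraic →
        ∀ (ℓ : ℕ) [Fact ℓ.Prime] (ι : PadicAlgCl ℓ ≃+* ℂ) (ρ : FramedGaloisRep K (PadicAlgCl ℓ) n),
          ρ.toGaloisRep.IsIrreducible → IsGeometricPinned ρ →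
            (∀ᶠ v : HeightOneSpectrum (𝓞 K) in cofinite, SatakeFrobCompatibleAt ι π.1 ρ v) →
              ∀ v : HeightOneSpectrum (𝓞 K), LocalGlobalCompatibleAt Rec ι π.1 ρ v

/-- **IsobaricRigidity (THE LEVER, Jacquet–Shalika 1981 II Thm 4.4 read at unramified places):**
the Satake family of a CUSPIDAL `π` on `GL_n` is not, at almost all places, the union of the
Satake families of `k ≥ 2` cuspidal representations of smaller `GL_{m_i}`.  Proof line in tree
vocabulary: twist to unitary families; `L^S(s, π × π̃_{i₀})` (`i₀` of maximal real twist
exponent) is finite on `Re s ≥ 1` by JS (2.2) (`JacquetShalika1981_partialPairL_boundary_repData`,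
`n ≠ m_{i₀}`) but factors as `∏_i L^S(s + s − s_i, π_i × π̃_{i₀})` with a pole from `i = i₀`
(JS (2.3), `JacquetShalika1981_partialPairL_pole_repData`) and non-vanishing other factors.
RESHAPED by the lead (L1): guard `0 < n` (the composition only uses positive rank). -/
def IsobaricRigidity : Prop :=
  ∀ (K : Type) [Field K] [NumberField K] (n : ℕ) (hcpt : isCompact_glFiniteIntegralLevel n K)
    (π : CuspidalAutomorphicRepData n K hcpt) (k : ℕ) (m : Fin k → ℕ)
    (hm : ∀ i, isCompact_glFiniteIntegralLevel (m i) K)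
    (σ : ∀ i, CuspidalAutomorphicRepData (m i) K (hm i)),
    0 < n → 2 ≤ k → (∀ i, 0 < m i) →
      ¬ ∀ᶠ v : HeightOneSpectrum (𝓞 K) in cofinite, ∀ α : Multiset ℂ, π.1.HasSatakeParamAt v α →
        ∃ β : Fin k → Multiset ℂ, (∀ i, (σ i).1.HasSatakeParamAt v (β i)) ∧ α = ∑ i, β i

/-- **GeometricConstituents (linear algebra + the pinned datum's sub-object stability):** a
geometric framed representation has a finite family of IRREDUCIBLE geometric framed
"constituents" whose Frobenius polynomials multiply to its own at every element, unramified
wherever it is, and it is irreducible as soon as there is exactly one constituent (a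
representation whose semisimplification is irreducible is irreducible — landed in rank 3 as
`stub_not_isIrreducible_of_charpoly_eq`). -/
def GeometricConstituents : Prop :=
  ∀ (K : Type) [Field K] [NumberField K] (ℓ : ℕ) [Fact ℓ.Prime] (n : ℕ)
    (ρ : FramedGaloisRep K (PadicAlgCl ℓ) n), 0 < n → IsGeometricPinned ρ →
      ∃ (k : ℕ) (m : Fin k → ℕ) (r : ∀ i, FramedGaloisRep K (PadicAlgCl ℓ) (m i)),
        (∀ i, 0 < m i ∧ (r i).toGaloisRep.IsIrreducible ∧ IsGeometricPinned (r i)) ∧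
        (∀ g : Field.absoluteGaloisGroup K, ρ.charpoly g = ∏ i, (r i).charpoly g) ∧
        (∀ v : HeightOneSpectrum (𝓞 K), ρ.IsUnramifiedAt v → ∀ i, (r i).IsUnramifiedAt v) ∧
        (k = 1 → ρ.toGaloisRep.IsIrreducible)

/-- **First lemma of the line (the bootstrap, irreducibility half):** under (B) for ALL ranks
over `K` (as the crux `E` provides, with one `Rec`), every geometric `ρ` attached a.e. to a
CUSPIDAL `π` is irreducible — "if Fontaine–Mazur–Langlands holds, reducibility of an attached
`ℓ`-adic representation shows `π` could not be cuspidal" (Calegari–Gee arXiv:1104.4827 §1 p. 3;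
Ramakrishnan arXiv:math/0609460 §0 (0.2)–(0.3)).  To be proved in crux-plan from the two
stubs above + `arithFrobPolyOfSatake_sum` + `arithFrobPolyOfSatake_one_injective`. -/
theorem isIrreducible_of_weakAutomorphy_allRanks
    (hJS : IsobaricRigidity) (hC : GeometricConstituents) (hB : WeakAutomorphy)
    (K : Type) [Field K] [NumberField K] (n : ℕ) (hcpt : isCompact_glFiniteIntegralLevel n K)
    (hn : 0 < n) (π : CuspidalAutomorphicRepData n K hcpt)
    (ℓ : ℕ) [Fact ℓ.Prime] (ι : PadicAlgCl ℓ ≃+* ℂ) (ρ : FramedGaloisRep K (PadicAlgCl ℓ) n)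
    (hgeo : IsGeometricPinned ρ)
    (hρ : ∀ᶠ v : HeightOneSpectrum (𝓞 K) in cofinite, SatakeFrobCompatibleAt ι π.1 ρ v) :
    ρ.toGaloisRep.IsIrreducible := by
  obtain ⟨k, m, r, hr, hchar, -, hone⟩ := hC K ℓ n ρ hn hgeo
  by_cases hk1 : k = 1
  · exact hone hk1
  -- `k = 0` is impossible: the characteristic polynomial of `ρ 1` has degree `n > 0`
  have hk0 : k ≠ 0 := by
    rintro rfl
    have h1 := hchar 1
    simp only [Finset.univ_eq_empty, Finset.prod_empty] at h1
    have hdeg : (FramedRep.charpoly ρ 1).natDegree = n := by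
      simp [FramedRep.charpoly, Matrix.charpoly_natDegree_eq_dim]
    rw [h1, natDegree_one] at hdeg
    omega
  have hk2 : 2 ≤ k := by omega
  -- (B) in rank `m i` makes every constituent automorphic
  have hσ : ∀ i, ∃ σ : CuspidalAutomorphicRepData (m i) K
      (isCompact_glFiniteIntegralLevel_holds (m i) K),
      σ.1.IsLAlgebraic ∧ ∀ᶠ v : HeightOneSpectrum (𝓞 K) in cofinite,
        SatakeFrobCompatibleAt ι σ.1 (r i) v :=
    fun i => hB K (m i) _ (hr i).1 ℓ ι (r i) (hr i).2.1 (hr i).2.2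
  choose σ _hσL hσc using hσ
  refine (hJS K n hcpt π k m (fun i => isCompact_glFiniteIntegralLevel_holds (m i) K) σ hn hk2
    (fun i => (hr i).1) ?_).elim
  have hall : ∀ᶠ v : HeightOneSpectrum (𝓞 K) in cofinite,
      ∀ i, SatakeFrobCompatibleAt ι (σ i).1 (r i) v :=
    Filter.eventually_all.mpr hσc
  filter_upwards [hρ, hall] with v hv hvi
  intro α hα
  obtain ⟨α₀, hα₀, -, hcp⟩ := hv
  obtain rfl : α = α₀ := AutomorphicRepData.hasSatakeParamAt_unique_holds π.1 hα hα₀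
  choose β hβ _hurβ hcpβ using hvi
  refine ⟨β, hβ, ?_⟩
  -- the Frobenius polynomial of `ρ` is the product of those of the constituents
  have hprod : ρ.HasFrobCharpolyAt v (∏ i, arithFrobPolyOfSatake ι v.residueCard 1 (β i)) := by
    intro 𝔓 h𝔓 τ hτ
    rw [hchar τ]
    exact Finset.prod_congr rfl fun i _ => hcpβ i 𝔓 h𝔓 τ hτ
  rw [← arithFrobPolyOfSatake_sum] at hprod
  have heq : arithFrobPolyOfSatake ι v.residueCard 1 α =
      arithFrobPolyOfSatake ι v.residueCard 1 (∑ i, β i) :=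
    GaloisRep.HasFrobCharpolyAt.unique_holds
      ((FramedGaloisRep.hasFrobCharpolyAt_toGaloisRep_iff v _ ρ).mpr hcp)
      ((FramedGaloisRep.hasFrobCharpolyAt_toGaloisRep_iff v _ ρ).mpr hprod)
  exact arithFrobPolyOfSatake_one_injective ι _ heq

/-- **The decoupling (composition theorem of the skeleton this card proposes), PROVED modulo
the named stubs:** `E ⟸ JS-rigidity ∧ constituents ∧ W ∧ B_w ∧ LGC`.  No strong multiplicity one
is needed: `PairCompatibility` is applied to the GIVEN `π`, and its `Rec` serves both conjuncts. -/
theorem reciprocityUpToIrreducibility_of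
    (hJS : IsobaricRigidity) (hC : GeometricConstituents)
    (hW : WeakExistence) (hB : WeakAutomorphy) (hL : PairCompatibility) :
    ReciprocityUpToIrreducibility := by
  intro F _ _
  obtain ⟨Rec, hRec⟩ := hL F
  refine ⟨Rec, fun n hn hcpt => ⟨fun π hLalg ℓ _ ι => ?_, fun ℓ _ ι ρ hirr hgeo => ?_⟩⟩
  · obtain ⟨ρ, hgeo, hρ⟩ := hW F n hcpt hn π hLalg ℓ ι
    have hirr : ρ.toGaloisRep.IsIrreducible :=
      isIrreducible_of_weakAutomorphy_allRanks hJS hC hB F n hcpt hn π ℓ ι ρ hgeo hρ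
    exact ⟨ρ, hgeo, hρ, hRec n hcpt hn π hLalg ℓ ι ρ hirr hgeo hρ⟩
  · obtain ⟨π, hLalg, hρ⟩ := hB F n hcpt hn ℓ ι ρ hirr hgeo
    exact ⟨π, hLalg, hρ, hRec n hcpt hn π hLalg ℓ ι ρ hirr hgeo hρ⟩

/-! ## 1b. The registered stubs (the ONLY sorries of this skeleton) and the crux BY NAME

LANDED (imported from the tree, same namespace): `stub_deRhamBlocks` (p98936, Literature heredity p97685),
`stub_geometricConstituents` (p99702, dévissage helper p98467), `stub_isobaricRigidity` (p105601, Literature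
`not_eventually_satake_eq_sum_of_JS` p102640), `stub_weakAutomorphy_of_fontaineMazurLanglandsGLn` (p117444,
on Literature `PstWeilDeligneModelIndependence`; continuation cycle c1), `stub_localGlobalCompatibleAtConj` (p119850)
`stub_correspondsOfExistsCorresponds` (p120067 `…Tightness.lean`), `stub_fontaineMazurLanglandsGLnPinned_of_crux`
(p120494 `…TightnessFM.lean`) and `stub_pairCompatibilityAbove_of_crux` (p120498 `…TightnessAbove.lean`; continuation cycle c2). -/

/-- **stub HJ (named fact; RESHAPED by lead c7 from the former `stub_jsPole`).**  Humphries–Jo (2024),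
Thm. 1.1 / Thm. 5.6: archimedean test vectors for the `GL_n × GL_n` Rankin–Selberg integral (with the
absolute convergence of the archimedean integrals for unitary data), in ranks `≥ 3` over every number
field — the accepted Literature text `HumphriesJo2024_archRankinSelberg_testVector N K`.  By the tree's
`JacquetShalika1981_partialPairL_pole_repData_of_humphriesJo_three_le` this is ALL that Arthur–Clozel (2.3)
for Borel–Jacquet data (`JacquetShalika1981_partialPairL_pole_repData`, the former stub K4') still rests on
(ranks `≤ 2` proved in the tree); the sorry now sits on a published archimedean theorem instead of on AC (2.3)
itself (cross-line evidence `jsPole-from-HJ.md`, 14329 lead c11, 2026-08-17).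
[cite: HumphriesJo2024, Thm. 1.1, Thm. 5.6] [cite: JacquetShalikaAJM1981II, Prop. 3.6] -/
theorem stub_humphriesJo_three_le :
    ∀ (N : ℕ) (K : Type) [Field K] [NumberField K],
      3 ≤ N → HumphriesJo2024_archRankinSelberg_testVector N K := by
  sorry

/-- **AC (2.3) for Borel–Jacquet data — the former bare stub `stub_jsPole`, now a THEOREM modulo the
Humphries–Jo stub** (reshaped by lead c7 on the cross-line evidence `jsPole-from-HJ.md` of the 14329 lead
c11): the tree's `JacquetShalika1981_partialPairL_pole_repData_of_humphriesJo_three_le`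
(`Literature/NumberTheory/Automorphic/PairLFunctionPolesRepDataOfHumphriesJo.lean`) derives the named fact
`JacquetShalika1981_partialPairL_pole_repData` in every rank from the archimedean test-vector fact of
Humphries–Jo (2024) in ranks `≥ 3` (ranks `≤ 2` are theorems of the tree).  So AC (2.3) no longer enters
the composition as a debt of its own: the only unproved input behind it is ONE published archimedean
theorem. [cite: ArthurClozelAMS120, Ch. 3 §2, (2.3), p. 171] [cite: HumphriesJo2024, Thm. 1.1, Thm. 5.6] -/
theorem jsPole_of_stubs : JacquetShalika1981_partialPairL_pole_repData :=
  JacquetShalika1981_partialPairL_pole_repData_of_humphriesJo_three_le stub_humphriesJo_three_le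

/-- **stub W (OPEN: Buzzard–Gee Conj. 3.2.2, weak form)**: every L-algebraic cuspidal `π` of
`GL_n(𝔸_K)` has, for all `ℓ, ι`, SOME pinned-geometric `ρ` Satake–Frobenius compatible a.e.
[cite: BuzzardGeeLMS2014, Conj. 3.2.2] -/
theorem stub_weakExistence :
    ∀ (K : Type) [Field K] [NumberField K] (n : ℕ) (hcpt : isCompact_glFiniteIntegralLevel n K),
      0 < n → ∀ π : CuspidalAutomorphicRepData n K hcpt, π.1.IsLAlgebraic →
        ∀ (ℓ : ℕ) [Fact ℓ.Prime] (ι : PadicAlgCl ℓ ≃+* ℂ),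
          ∃ ρ : FramedGaloisRep K (PadicAlgCl ℓ) n,
            ((∀ᶠ v : HeightOneSpectrum (𝓞 K) in cofinite, ρ.IsUnramifiedAt v) ∧
              ∀ (v : HeightOneSpectrum (𝓞 K)) (hv : ((ℓ : ℕ) : 𝓞 K) ∈ v.asIdeal),
                (Literature.NumberTheory.PAdicHodge.fontainePstAdicCompletion v ℓ hv).IsDeRhamFramed
                  (ρ.toLocal v)) ∧
            ∀ᶠ v : HeightOneSpectrum (𝓞 K) in cofinite, SatakeFrobCompatibleAt ι π.1 ρ v := by
  sorry

/-- **stub lang.S03 (OPEN: Fontaine–Mazur–Langlands for `GL_n`, the accepted Literature text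
`FontaineMazurLanglandsGLn`, for every rank, at the pinned family of period-ring data)**
`𝔅 K ℓ v hv := ⟨(fontainePstAdicCompletion v ℓ hv).algebra, (fontainePstAdicCompletion v ℓ hv).𝔅⟩`:
every irreducible `ρ : Γ_K → GL_n(ℚ̄_ℓ)` with a geometric finite model is Satake–Frobenius compatible
a.e. with some L-algebraic cuspidal `π`.  RESHAPED by the continuation lead (c1): this named text
replaces the former bare stub `stub_weakAutomorphy` (B_w), which follows from it by the landed
registered stub `stub_weakAutomorphy_of_fontaineMazurLanglandsGLn` (model independence of de
Rham-ness + `exists_hasQlModel_holds`).  Rank `0` is vacuous (no irreducible rank-0 representation).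
[cite: FontaineMazurGeometric1995, Conj. 1] [cite: BuzzardGeeLMS2014, Conj. 3.2.2] -/
theorem stub_fontaineMazurLanglandsGLn :
    ∀ n : ℕ, FontaineMazurLanglandsGLn
      (fun (K : Type) [Field K] [NumberField K] (ℓ : ℕ) [Fact ℓ.Prime]
          (v : HeightOneSpectrum (𝓞 K)) (hv : ((ℓ : ℕ) : 𝓞 K) ∈ v.asIdeal) =>
        ⟨(Literature.NumberTheory.PAdicHodge.fontainePstAdicCompletion v ℓ hv).algebra,
          (Literature.NumberTheory.PAdicHodge.fontainePstAdicCompletion v ℓ hv).𝔅⟩) n := by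
  sorry

/-- **B_w (Fontaine–Mazur–Langlands, a.e. form; the former `stub_weakAutomorphy`, verbatim) from the
named stub**: every irreducible pinned-geometric `ρ : Γ_K → GL_n(ℚ̄_ℓ)` is Satake–Frobenius compatible
a.e. with some L-algebraic cuspidal `π` — by `stub_weakAutomorphy_of_fontaineMazurLanglandsGLn`
(landed) applied to `stub_fontaineMazurLanglandsGLn`. [cite: FontaineMazurGeometric1995, Conj. 1] -/
theorem weakAutomorphy_of_stubs :
    ∀ (K : Type) [Field K] [NumberField K] (n : ℕ) (hcpt : isCompact_glFiniteIntegralLevel n K),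
      0 < n → ∀ (ℓ : ℕ) [Fact ℓ.Prime] (ι : PadicAlgCl ℓ ≃+* ℂ) (ρ : FramedGaloisRep K (PadicAlgCl ℓ) n),
        ρ.toGaloisRep.IsIrreducible →
        ((∀ᶠ v : HeightOneSpectrum (𝓞 K) in cofinite, ρ.IsUnramifiedAt v) ∧
          ∀ (v : HeightOneSpectrum (𝓞 K)) (hv : ((ℓ : ℕ) : 𝓞 K) ∈ v.asIdeal),
            (Literature.NumberTheory.PAdicHodge.fontainePstAdicCompletion v ℓ hv).IsDeRhamFramed
              (ρ.toLocal v)) →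
          ∃ π : CuspidalAutomorphicRepData n K hcpt, π.1.IsLAlgebraic ∧
            ∀ᶠ v : HeightOneSpectrum (𝓞 K) in cofinite, SatakeFrobCompatibleAt ι π.1 ρ v :=
  stub_weakAutomorphy_of_fontaineMazurLanglandsGLn stub_fontaineMazurLanglandsGLn

/-- **stub LGC-away (OPEN: Taylor 2004 Conj. 7 at `v ∤ ℓ` for irreducible pairs; Varma-type
content)**: for every number field ONE reciprocity datum `Rec` such that every irreducible
pinned-geometric `ρ` a.e.-compatible with an L-algebraic cuspidal `π` is locally–globally compatible with
it at every finite place AWAY from `ℓ` (there the Grothendieck–Deligne relation `IsWeilDeligneOfLadic` is a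
definition of the tree, so the clause is meaningful today).  RESHAPED by the lead in cycle 1 on the
disprover's `stub-misstated: stub_pairCompatibility` (Disproof §B–§D): the former single stub is split
into this half and `stub_pairCompatibilityAbove`. [cite: HarrisTaylorAMS2001, Thm. A] -/
theorem stub_pairCompatibilityAway :
    ∀ (K : Type) [Field K] [NumberField K], ∃ Rec : ReciprocityData K,
      ∀ (n : ℕ) (hcpt : isCompact_glFiniteIntegralLevel n K), 0 < n →
        ∀ (π : CuspidalAutomorphicRepData n K hcpt), π.1.IsLAlgebraic →
          ∀ (ℓ : ℕ) [Fact ℓ.Prime] (ι : PadicAlgCl ℓ ≃+* ℂ) (ρ : FramedGaloisRep K (PadicAlgCl ℓ) n),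
            ρ.toGaloisRep.IsIrreducible →
            ((∀ᶠ v : HeightOneSpectrum (𝓞 K) in cofinite, ρ.IsUnramifiedAt v) ∧
              ∀ (v : HeightOneSpectrum (𝓞 K)) (hv : ((ℓ : ℕ) : 𝓞 K) ∈ v.asIdeal),
                (Literature.NumberTheory.PAdicHodge.fontainePstAdicCompletion v ℓ hv).IsDeRhamFramed
                  (ρ.toLocal v)) →
              (∀ᶠ v : HeightOneSpectrum (𝓞 K) in cofinite, SatakeFrobCompatibleAt ι π.1 ρ v) →
                ∀ v : HeightOneSpectrum (𝓞 K), ((ℓ : ℕ) : 𝓞 K) ∉ v.asIdeal →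
                  LocalGlobalCompatibleAt Rec ι π.1 ρ v := by
  sorry

/-- **stub LGC-above (OPEN and, in the present tree, FORMALLY BLOCKED: Taylor 2004 Conj. 7 at `v ∣ ℓ`
through Fontaine's PINNED `D_pst` datum)**: for every reciprocity datum `Rec` that is already
locally–globally compatible away from `ℓ` for all irreducible pinned-geometric pairs (the antecedent is
VERBATIM the body of `stub_pairCompatibilityAway` for this `Rec`), compatibility also holds at the places
above `ℓ`.  Blocked on the definition item `defn-FontainePstWeilDeligneData` (components (ii)–(iii):
construction of `B_dR(K_v)` and `WD ∘ D_pst`, the upgrade path D1/D2 of `FontaineDpst`): the disprover's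
`reciprocityUpToIrreducibility_separates_fontaineSpec` (Disproof §C, landed Negative/
`PinnedFontaineDatumUndecided`) shows the `v ∣ ℓ` clause for the ε-pinned datum is independent of the
present tree. [cite: FontaineAsterisque223VIII, §2.3.7] -/
theorem stub_pairCompatibilityAbove :
    ∀ (K : Type) [Field K] [NumberField K] (Rec : ReciprocityData K),
      (∀ (n : ℕ) (hcpt : isCompact_glFiniteIntegralLevel n K), 0 < n →
        ∀ (π : CuspidalAutomorphicRepData n K hcpt), π.1.IsLAlgebraic →
          ∀ (ℓ : ℕ) [Fact ℓ.Prime] (ι : PadicAlgCl ℓ ≃+* ℂ) (ρ : FramedGaloisRep K (PadicAlgCl ℓ) n),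
            ρ.toGaloisRep.IsIrreducible →
            ((∀ᶠ v : HeightOneSpectrum (𝓞 K) in cofinite, ρ.IsUnramifiedAt v) ∧
              ∀ (v : HeightOneSpectrum (𝓞 K)) (hv : ((ℓ : ℕ) : 𝓞 K) ∈ v.asIdeal),
                (Literature.NumberTheory.PAdicHodge.fontainePstAdicCompletion v ℓ hv).IsDeRhamFramed
                  (ρ.toLocal v)) →
              (∀ᶠ v : HeightOneSpectrum (𝓞 K) in cofinite, SatakeFrobCompatibleAt ι π.1 ρ v) →
                ∀ v : HeightOneSpectrum (𝓞 K), ((ℓ : ℕ) : 𝓞 K) ∉ v.asIdeal →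
                  LocalGlobalCompatibleAt Rec ι π.1 ρ v) →
      ∀ (n : ℕ) (hcpt : isCompact_glFiniteIntegralLevel n K), 0 < n →
        ∀ (π : CuspidalAutomorphicRepData n K hcpt), π.1.IsLAlgebraic →
          ∀ (ℓ : ℕ) [Fact ℓ.Prime] (ι : PadicAlgCl ℓ ≃+* ℂ) (ρ : FramedGaloisRep K (PadicAlgCl ℓ) n),
            ρ.toGaloisRep.IsIrreducible →
            ((∀ᶠ v : HeightOneSpectrum (𝓞 K) in cofinite, ρ.IsUnramifiedAt v) ∧
              ∀ (v : HeightOneSpectrum (𝓞 K)) (hv : ((ℓ : ℕ) : 𝓞 K) ∈ v.asIdeal),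
                (Literature.NumberTheory.PAdicHodge.fontainePstAdicCompletion v ℓ hv).IsDeRhamFramed
                  (ρ.toLocal v)) →
              (∀ᶠ v : HeightOneSpectrum (𝓞 K) in cofinite, SatakeFrobCompatibleAt ι π.1 ρ v) →
                ∀ v : HeightOneSpectrum (𝓞 K), ((ℓ : ℕ) : 𝓞 K) ∈ v.asIdeal →
                  LocalGlobalCompatibleAt Rec ι π.1 ρ v := by
  sorry

/-- **Glue for the reshaped LGC stub**: `PairCompatibility` from its away/above halves (the `Rec` of
the away half, upgraded above `ℓ` by the above half; case split on `ℓ ∈ v`). [folklore] -/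
theorem pairCompatibility_of_away_above : PairCompatibility := by
  intro K _ _
  obtain ⟨Rec, hA⟩ := stub_pairCompatibilityAway K
  refine ⟨Rec, fun n hcpt hn π hL ℓ _ ι ρ hirr hgeo hρ v => ?_⟩
  by_cases hv : ((ℓ : ℕ) : 𝓞 K) ∈ v.asIdeal
  · exact stub_pairCompatibilityAbove K Rec hA n hcpt hn π hL ℓ ι ρ hirr hgeo hρ v hv
  · exact hA n hcpt hn π hL ℓ ι ρ hirr hgeo hρ v hv

/-- **The crux BY NAME from the registered stubs and the route's registered input `PairLBoundaryJS`**
(item stmt-Langlands-13622 = the named fact `JacquetShalika1981_partialPairL_boundary_repData`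
verbatim, `PairLBoundaryJS_iff_partialPairL_boundary_repData` is `Iff.rfl`).  The stubs are stated
in tree vocabulary (the section-1 `def`s unfolded) and are fed to the glue by definitional unfolding. -/
theorem ReciprocityUpToIrreducibility_of
    (hPLB : Summit.Langlands.Langlands.Theses.IrreducibilityBySelfDuality.PairLBoundaryJS) :
    Summit.Langlands.Langlands.Theses.IrreducibilityBySelfDuality.ReciprocityUpToIrreducibility :=
  reciprocityUpToIrreducibility_of (stub_isobaricRigidity hPLB jsPole_of_stubs)
    (stub_geometricConstituents stub_deRhamBlocks) stub_weakExistence weakAutomorphy_of_stubs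
    pairCompatibility_of_away_above

/-- **By-product: the crux IS the summit.**  `E → Langlands` given the two rigidity stubs (the
prover's p78886 has `Langlands ↔ E ∧ I`; the bootstrap supplies `I` from `E`). -/
theorem langlands_of_reciprocityUpToIrreducibility
    (hJS : IsobaricRigidity) (hC : GeometricConstituents) (hE : ReciprocityUpToIrreducibility) :
    _root_.Langlands := by
  -- (B) of the crux, read weakly, for every field and rank
  have hBw : WeakAutomorphy := by
    intro K _ _ n hcpt hn ℓ _ ι ρ hirr hgeo
    obtain ⟨Rec, hRec⟩ := hE K
    obtain ⟨-, hB⟩ := hRec n hn hcpt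
    obtain ⟨π, hL, hcorr⟩ := hB ℓ ι ρ hirr hgeo
    exact ⟨π, hL, hcorr.1⟩
  refine langlands_iff_reciprocityUpToIrreducibility_and_irreducible.mpr ⟨hE, ?_⟩
  intro n K _ _ hcpt hn π hL ℓ _ ι ρ hρ
  obtain ⟨Rec, hRec⟩ := hE K
  obtain ⟨hA, -⟩ := hRec n hn hcpt
  obtain ⟨ρ₀, hgeo₀, hcorr₀⟩ := hA π hL ℓ ι
  -- the bootstrap: the avatar the crux provides is irreducible
  have hirr₀ : ρ₀.toGaloisRep.IsIrreducible :=
    isIrreducible_of_weakAutomorphy_allRanks hJS hC hBw K n hcpt hn π ℓ ι ρ₀ hgeo₀ hcorr₀.1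
  -- any other a.e.-compatible `ρ`: its continuous semisimplification is equivalent to `ρ₀`
  obtain ⟨r, hrss, hrcp, hrker⟩ := stub_continuousSemisimplification K ℓ n ρ
  have hs₀ : ρ₀.toGaloisRep.IsSemisimple := by
    haveI := hirr₀
    change ComplementedLattice _
    infer_instance
  have hev : ∀ᶠ v : HeightOneSpectrum (𝓞 K) in cofinite,
      ρ₀.IsUnramifiedAt v ∧ r.IsUnramifiedAt v ∧
        ∃ P : Polynomial (PadicAlgCl ℓ), ρ₀.HasFrobCharpolyAt v P ∧ r.HasFrobCharpolyAt v P := by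
    filter_upwards [hcorr₀.1, hρ] with v hv₀ hv
    obtain ⟨α₀, hα₀, hur₀, hcp₀⟩ := hv₀
    obtain ⟨α, hα, hur, hcp⟩ := hv
    obtain rfl : α = α₀ := AutomorphicRepData.hasSatakeParamAt_unique_holds π.1 hα hα₀
    exact ⟨hur₀, fun 𝔓 h𝔓 σ hσ => hrker σ (hur 𝔓 h𝔓 σ hσ), _, hcp₀,
      fun 𝔓 h𝔓 σ hσ => (hrcp σ).trans (hcp 𝔓 h𝔓 σ hσ)⟩
  obtain ⟨e⟩ :=
    FramedGaloisRep.nonempty_equiv_of_hasFrobCharpolyAt_eventually chebotarev_artinRep_holds ρ₀ r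
      hs₀ hrss hev
  have hrirr : r.toGaloisRep.IsIrreducible := by
    haveI := hirr₀
    exact Literature.RepresentationTheory.Semisimple.Representation.isIrreducible_of_equiv e.toRepEquiv
  by_contra hirr
  exact stub_not_isIrreducible_of_charpoly_eq K ℓ n ρ r hrss hrcp hirr hrirr

/-! ## 1c. Tightness of the line (continuation lead c2): the crux implies each open stub

`E → W` and `E → B_w` are immediate.  `E → LGC` (`PairCompatibility`; in particular the `∃ Rec`
statement of `stub_pairCompatibilityAway`) is the **weak-to-strong upgrade**: given an irreducible
pinned-geometric `ρ` a.e.-compatible with `π`, direction (A') of `E` gives SOME `ρ_π` corresponding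
to `π` at every finite place; `ρ_π` is irreducible by transfer
(`IrreducibleOffSector.isIrreducible_of_satakeFrobCompatible`), hence conjugate to `ρ` (Chebotarev +
Brauer–Nesbitt: `FramedGaloisRep.nonempty_equiv_of_hasFrobCharpolyAt_eventually` with
`chebotarev_artinRep_holds`, then `FramedRep.exists_eq_conj_of_equiv`), and `Corresponds` descends to
conjugacy classes — the one non-formal point being that `LocalGlobalCompatibleAt` is invariant under
a change of frame (at `v ∤ ℓ` the Weil–Deligne representation of the Grothendieck–Deligne recipe, a
literal matrix identity, must be conjugated along with `ρ`, its complex transport by `ι(P)`, and the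
Frobenius-semisimple class is an isomorphism invariant; at `v ∣ ℓ` the pinned datum's structure
field `PstWeilDeligneData.conj`).  That point is the theorem-grade stub
`stub_localGlobalCompatibleAtConj`; the upgrade is the theorem-grade stub
`stub_correspondsOfExistsCorresponds` (= the open support item `NewtonPatching.WeakToStrong` with
its strong-(A) hypothesis weakened to `∃ ρ', Corresponds`).  Both are LANDED by c2 and imported here
(`Theorems/…ReciprocityUpToIrreducibilityCorrespondsConj.lean` p119850, `…Tightness.lean`).  Consequence:
modulo the route input AC (2.2) and the stub AC (2.3) the decoupling is an EQUIVALENCE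
`E ↔ W ∧ B_w ∧ LGC` (`reciprocityUpToIrreducibility_iff_weak`): each of W, B_w, LGC is implied by
the crux, so none of them can be replaced by something weaker along this line — they are honestly
crux-sized (W = BG Conj. 3.2.2 weak form, B_w ⇐ lang.S03, LGC = Taylor Conj. 7 for irreducible pairs). -/

/-- `Corresponds` descends to conjugacy classes (Satake clause: in-tree invariance of unramifiedness
and of the Frobenius characteristic polynomial; local–global clause: `stub_localGlobalCompatibleAtConj`)
— the frame-change half of `stub_correspondsOfExistsCorresponds`. [cite: DeligneAntwerpII1973, §8.4] -/
theorem corresponds_of_isConjugate_of_stub {K : Type} [Field K] [NumberField K] {n : ℕ}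
    {hcpt : isCompact_glFiniteIntegralLevel n K} {Rec : ReciprocityData K} {ℓ : ℕ} [Fact ℓ.Prime]
    {ι : PadicAlgCl ℓ ≃+* ℂ} {π : CuspidalAutomorphicRepData n K hcpt}
    {ρ ρ' : FramedGaloisRep K (PadicAlgCl ℓ) n} (h : Corresponds Rec ι π.1 ρ) (hc : IsConjugate ρ ρ') :
    Corresponds Rec ι π.1 ρ' := by
  obtain ⟨P, rfl⟩ := hc
  refine ⟨h.1.mono fun v hv => ?_,
    fun v => stub_localGlobalCompatibleAtConj K n hcpt Rec ℓ ι π P ρ v (h.2 v)⟩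
  obtain ⟨α, hα, hur, hcp⟩ := hv
  exact ⟨α, hα, (FramedGaloisRep.isUnramifiedAt_conj_iff v P ρ).mpr hur, fun 𝔓 h𝔓 σ hσ =>
    (Summit.Langlands.Langlands.Theorems.IrreducibleOffSector.charpoly_conj P ρ σ).trans
      (hcp 𝔓 h𝔓 σ hσ)⟩

/-- The Chebotarev half of `stub_correspondsOfExistsCorresponds`, in the tree: two avatars of one `π`,
one irreducible, are conjugate. [cite: DeligneSerreASENS1974, Lemme 3.2] -/
theorem isConjugate_of_satakeFrobCompatibleAt_skel {K : Type} [Field K] [NumberField K] {n : ℕ}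
    {hcpt : isCompact_glFiniteIntegralLevel n K} {ℓ : ℕ} [Fact ℓ.Prime] (ι : PadicAlgCl ℓ ≃+* ℂ)
    (π : CuspidalAutomorphicRepData n K hcpt) {ρ₀ ρ : FramedGaloisRep K (PadicAlgCl ℓ) n}
    (hirr₀ : ρ₀.toGaloisRep.IsIrreducible)
    (h₀ : ∀ᶠ v : HeightOneSpectrum (𝓞 K) in cofinite, SatakeFrobCompatibleAt ι π.1 ρ₀ v)
    (h : ∀ᶠ v : HeightOneSpectrum (𝓞 K) in cofinite, SatakeFrobCompatibleAt ι π.1 ρ v) :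
    IsConjugate ρ₀ ρ := by
  have hirr : ρ.toGaloisRep.IsIrreducible :=
    Summit.Langlands.Langlands.Theorems.IrreducibleOffSector.isIrreducible_of_satakeFrobCompatible
      π.1 ι hirr₀ h₀ h
  obtain ⟨e⟩ := FramedGaloisRep.nonempty_equiv_of_hasFrobCharpolyAt_eventually
    chebotarev_artinRep_holds ρ₀ ρ
    (Summit.Langlands.Langlands.Theorems.IrreducibleOffSector.isSemisimple_of_isIrreducible ρ₀ hirr₀)
    (Summit.Langlands.Langlands.Theorems.IrreducibleOffSector.isSemisimple_of_isIrreducible ρ hirr)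
    (Summit.Langlands.Langlands.Theorems.IrreducibleOffSector.eventually_hasFrobCharpolyAt_common
      π.1 ι h₀ h)
  obtain ⟨P, hP⟩ := FramedRep.exists_eq_conj_of_equiv ρ₀ ρ e
  exact ⟨P, hP.symm⟩

/-- Sanity (joint sufficiency of the two c2 stubs): the weak-to-strong stub follows from the
frame-change stub and the in-tree Chebotarev rigidity. [cite: DeligneSerreASENS1974, Lemme 3.2] -/
theorem correspondsOfExistsCorresponds_of_stubConj {K : Type} [Field K] [NumberField K] {n : ℕ}
    {hcpt : isCompact_glFiniteIntegralLevel n K} {Rec : ReciprocityData K} {ℓ : ℕ} [Fact ℓ.Prime]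
    {ι : PadicAlgCl ℓ ≃+* ℂ} {π : CuspidalAutomorphicRepData n K hcpt}
    {ρ : FramedGaloisRep K (PadicAlgCl ℓ) n} (hirr : ρ.toGaloisRep.IsIrreducible)
    (hρ : ∀ᶠ v : HeightOneSpectrum (𝓞 K) in cofinite, SatakeFrobCompatibleAt ι π.1 ρ v)
    (hA : ∃ ρ' : FramedGaloisRep K (PadicAlgCl ℓ) n, Corresponds Rec ι π.1 ρ') :
    Corresponds Rec ι π.1 ρ := by
  obtain ⟨ρ', h'⟩ := hA
  exact corresponds_of_isConjugate_of_stub h'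
    (isConjugate_of_satakeFrobCompatibleAt_skel ι π
      (Summit.Langlands.Langlands.Theorems.IrreducibleOffSector.isIrreducible_of_satakeFrobCompatible
        π.1 ι hirr hρ h'.1) h'.1 hρ)

/-- **Tightness, W** (section-1 `def` form; the tree copy `weakExistence_of_reciprocityUpToIrreducibility`
of `…Tightness.lean` is the unfolded statement): the crux implies weak existence. [folklore] -/
theorem weakExistence_of_crux (hE : ReciprocityUpToIrreducibility) : WeakExistence :=
  weakExistence_of_reciprocityUpToIrreducibility hE

/-- **Tightness, B_w** (`def` form): the crux implies weak automorphy. [folklore] -/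
theorem weakAutomorphy_of_crux (hE : ReciprocityUpToIrreducibility) : WeakAutomorphy :=
  weakAutomorphy_of_reciprocityUpToIrreducibility hE

/-- **Tightness, LGC** (`def` form): the crux implies local–global compatibility for irreducible pairs,
with the crux's own `Rec` (weak-to-strong upgrade = the landed stub `stub_correspondsOfExistsCorresponds`
applied to direction (A')). [cite: DeligneSerreASENS1974, Lemme 3.2] -/
theorem pairCompatibility_of_crux (hE : ReciprocityUpToIrreducibility) : PairCompatibility :=
  pairCompatibility_of_reciprocityUpToIrreducibility hE

/-- **The decoupling is an equivalence** modulo the route input AC (2.2) (and the stub AC (2.3)):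
`E ↔ W ∧ B_w ∧ LGC` (`def` form; tree copy `reciprocityUpToIrreducibility_iff_weak` takes AC (2.3) as a
hypothesis instead of the stub). [folklore] -/
theorem crux_iff_weak
    (hPLB : Summit.Langlands.Langlands.Theses.IrreducibilityBySelfDuality.PairLBoundaryJS) :
    Summit.Langlands.Langlands.Theses.IrreducibilityBySelfDuality.ReciprocityUpToIrreducibility ↔
      WeakExistence ∧ WeakAutomorphy ∧ PairCompatibility :=
  ⟨fun hE => ⟨weakExistence_of_crux hE, weakAutomorphy_of_crux hE, pairCompatibility_of_crux hE⟩,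
    fun h => reciprocityUpToIrreducibility_of (stub_isobaricRigidity hPLB jsPole_of_stubs)
      (stub_geometricConstituents stub_deRhamBlocks) h.1 h.2.1 h.2.2⟩

/-- **Tightness, lang.S03 / B_w:** at the pinned family, the named conjecture text lang.S03 (all ranks),
the weak automorphy statement B_w and "implied by the crux" line up:
`E → lang.S03(pinned) → B_w` and `E → B_w` directly. [cite: FontaineMazurGeometric1995, Conj. 1] -/
theorem fontaineMazurLanglandsGLnPinned_iff_of_crux
    (hE : Summit.Langlands.Langlands.Theses.IrreducibilityBySelfDuality.ReciprocityUpToIrreducibility) :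
    (∀ n : ℕ, FontaineMazurLanglandsGLn
        (fun (K : Type) [Field K] [NumberField K] (ℓ : ℕ) [Fact ℓ.Prime]
            (v : HeightOneSpectrum (𝓞 K)) (hv : ((ℓ : ℕ) : 𝓞 K) ∈ v.asIdeal) =>
          ⟨(Literature.NumberTheory.PAdicHodge.fontainePstAdicCompletion v ℓ hv).algebra,
            (Literature.NumberTheory.PAdicHodge.fontainePstAdicCompletion v ℓ hv).𝔅⟩) n) ∧
      WeakAutomorphy :=
  ⟨stub_fontaineMazurLanglandsGLnPinned_of_crux hE,
    stub_weakAutomorphy_of_fontaineMazurLanglandsGLn (stub_fontaineMazurLanglandsGLnPinned_of_crux hE)⟩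

/-- **The crux implies `stub_pairCompatibilityAbove`** given the route input AC (2.2) (AC (2.3) from the
stub). [cite: DeligneAntwerpII1973, §8.4.2] -/
theorem pairCompatibilityAbove_of_crux
    (hPLB : Summit.Langlands.Langlands.Theses.IrreducibilityBySelfDuality.PairLBoundaryJS)
    (hE : Summit.Langlands.Langlands.Theses.IrreducibilityBySelfDuality.ReciprocityUpToIrreducibility) :
    ∀ (K : Type) [Field K] [NumberField K] (Rec : ReciprocityData K),
      (∀ (n : ℕ) (hcpt : isCompact_glFiniteIntegralLevel n K), 0 < n →
        ∀ (π : CuspidalAutomorphicRepData n K hcpt), π.1.IsLAlgebraic →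
          ∀ (ℓ : ℕ) [Fact ℓ.Prime] (ι : PadicAlgCl ℓ ≃+* ℂ) (ρ : FramedGaloisRep K (PadicAlgCl ℓ) n),
            ρ.toGaloisRep.IsIrreducible →
            ((∀ᶠ v : HeightOneSpectrum (𝓞 K) in cofinite, ρ.IsUnramifiedAt v) ∧
              ∀ (v : HeightOneSpectrum (𝓞 K)) (hv : ((ℓ : ℕ) : 𝓞 K) ∈ v.asIdeal),
                (Literature.NumberTheory.PAdicHodge.fontainePstAdicCompletion v ℓ hv).IsDeRhamFramed
                  (ρ.toLocal v)) →
              (∀ᶠ v : HeightOneSpectrum (𝓞 K) in cofinite, SatakeFrobCompatibleAt ι π.1 ρ v) →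
                ∀ v : HeightOneSpectrum (𝓞 K), ((ℓ : ℕ) : 𝓞 K) ∉ v.asIdeal →
                  LocalGlobalCompatibleAt Rec ι π.1 ρ v) →
      ∀ (n : ℕ) (hcpt : isCompact_glFiniteIntegralLevel n K), 0 < n →
        ∀ (π : CuspidalAutomorphicRepData n K hcpt), π.1.IsLAlgebraic →
          ∀ (ℓ : ℕ) [Fact ℓ.Prime] (ι : PadicAlgCl ℓ ≃+* ℂ) (ρ : FramedGaloisRep K (PadicAlgCl ℓ) n),
            ρ.toGaloisRep.IsIrreducible →
            ((∀ᶠ v : HeightOneSpectrum (𝓞 K) in cofinite, ρ.IsUnramifiedAt v) ∧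
              ∀ (v : HeightOneSpectrum (𝓞 K)) (hv : ((ℓ : ℕ) : 𝓞 K) ∈ v.asIdeal),
                (Literature.NumberTheory.PAdicHodge.fontainePstAdicCompletion v ℓ hv).IsDeRhamFramed
                  (ρ.toLocal v)) →
              (∀ᶠ v : HeightOneSpectrum (𝓞 K) in cofinite, SatakeFrobCompatibleAt ι π.1 ρ v) →
                ∀ v : HeightOneSpectrum (𝓞 K), ((ℓ : ℕ) : 𝓞 K) ∈ v.asIdeal →
                  LocalGlobalCompatibleAt Rec ι π.1 ρ v :=
  stub_pairCompatibilityAbove_of_crux hPLB jsPole_of_stubs hE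

/-- **THE LINE IS EXACTLY CRUX-SIZED, STUB BY STUB** (c2): granted the route input AC (2.2) (and AC
(2.3) = `stub_jsPole`), the crux is EQUIVALENT to the conjunction of the line's four other open stubs
taken verbatim — W (`stub_weakExistence`), lang.S03 at the pinned family (`stub_fontaineMazurLanglandsGLn`),
LGC-away (`stub_pairCompatibilityAway`) and LGC-above (`stub_pairCompatibilityAbove`).  `←` is the
line's composition; `→` is the tightness certificate (`…Tightness`, `…TightnessFM`, `…TightnessAbove`).
[cite: BuzzardGeeLMS2014, Conj. 3.2.2] -/
theorem crux_iff_openStubs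
    (hPLB : Summit.Langlands.Langlands.Theses.IrreducibilityBySelfDuality.PairLBoundaryJS) :
    Summit.Langlands.Langlands.Theses.IrreducibilityBySelfDuality.ReciprocityUpToIrreducibility ↔
    (WeakExistence ∧
     (∀ n : ℕ, FontaineMazurLanglandsGLn
        (fun (K : Type) [Field K] [NumberField K] (ℓ : ℕ) [Fact ℓ.Prime]
            (v : HeightOneSpectrum (𝓞 K)) (hv : ((ℓ : ℕ) : 𝓞 K) ∈ v.asIdeal) =>
          ⟨(Literature.NumberTheory.PAdicHodge.fontainePstAdicCompletion v ℓ hv).algebra,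
            (Literature.NumberTheory.PAdicHodge.fontainePstAdicCompletion v ℓ hv).𝔅⟩) n) ∧
     (∀ (K : Type) [Field K] [NumberField K], ∃ Rec : ReciprocityData K,
      ∀ (n : ℕ) (hcpt : isCompact_glFiniteIntegralLevel n K), 0 < n →
        ∀ (π : CuspidalAutomorphicRepData n K hcpt), π.1.IsLAlgebraic →
          ∀ (ℓ : ℕ) [Fact ℓ.Prime] (ι : PadicAlgCl ℓ ≃+* ℂ) (ρ : FramedGaloisRep K (PadicAlgCl ℓ) n),
            ρ.toGaloisRep.IsIrreducible →
            ((∀ᶠ v : HeightOneSpectrum (𝓞 K) in cofinite, ρ.IsUnramifiedAt v) ∧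
              ∀ (v : HeightOneSpectrum (𝓞 K)) (hv : ((ℓ : ℕ) : 𝓞 K) ∈ v.asIdeal),
                (Literature.NumberTheory.PAdicHodge.fontainePstAdicCompletion v ℓ hv).IsDeRhamFramed
                  (ρ.toLocal v)) →
              (∀ᶠ v : HeightOneSpectrum (𝓞 K) in cofinite, SatakeFrobCompatibleAt ι π.1 ρ v) →
                ∀ v : HeightOneSpectrum (𝓞 K), ((ℓ : ℕ) : 𝓞 K) ∉ v.asIdeal →
                  LocalGlobalCompatibleAt Rec ι π.1 ρ v) ∧
     (∀ (K : Type) [Field K] [NumberField K] (Rec : ReciprocityData K),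
      (∀ (n : ℕ) (hcpt : isCompact_glFiniteIntegralLevel n K), 0 < n →
        ∀ (π : CuspidalAutomorphicRepData n K hcpt), π.1.IsLAlgebraic →
          ∀ (ℓ : ℕ) [Fact ℓ.Prime] (ι : PadicAlgCl ℓ ≃+* ℂ) (ρ : FramedGaloisRep K (PadicAlgCl ℓ) n),
            ρ.toGaloisRep.IsIrreducible →
            ((∀ᶠ v : HeightOneSpectrum (𝓞 K) in cofinite, ρ.IsUnramifiedAt v) ∧
              ∀ (v : HeightOneSpectrum (𝓞 K)) (hv : ((ℓ : ℕ) : 𝓞 K) ∈ v.asIdeal),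
                (Literature.NumberTheory.PAdicHodge.fontainePstAdicCompletion v ℓ hv).IsDeRhamFramed
                  (ρ.toLocal v)) →
              (∀ᶠ v : HeightOneSpectrum (𝓞 K) in cofinite, SatakeFrobCompatibleAt ι π.1 ρ v) →
                ∀ v : HeightOneSpectrum (𝓞 K), ((ℓ : ℕ) : 𝓞 K) ∉ v.asIdeal →
                  LocalGlobalCompatibleAt Rec ι π.1 ρ v) →
      ∀ (n : ℕ) (hcpt : isCompact_glFiniteIntegralLevel n K), 0 < n →
        ∀ (π : CuspidalAutomorphicRepData n K hcpt), π.1.IsLAlgebraic →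
          ∀ (ℓ : ℕ) [Fact ℓ.Prime] (ι : PadicAlgCl ℓ ≃+* ℂ) (ρ : FramedGaloisRep K (PadicAlgCl ℓ) n),
            ρ.toGaloisRep.IsIrreducible →
            ((∀ᶠ v : HeightOneSpectrum (𝓞 K) in cofinite, ρ.IsUnramifiedAt v) ∧
              ∀ (v : HeightOneSpectrum (𝓞 K)) (hv : ((ℓ : ℕ) : 𝓞 K) ∈ v.asIdeal),
                (Literature.NumberTheory.PAdicHodge.fontainePstAdicCompletion v ℓ hv).IsDeRhamFramed
                  (ρ.toLocal v)) →
              (∀ᶠ v : HeightOneSpectrum (𝓞 K) in cofinite, SatakeFrobCompatibleAt ι π.1 ρ v) →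
                ∀ v : HeightOneSpectrum (𝓞 K), ((ℓ : ℕ) : 𝓞 K) ∈ v.asIdeal →
                  LocalGlobalCompatibleAt Rec ι π.1 ρ v)) := by
  refine ⟨fun hE => ⟨weakExistence_of_crux hE, stub_fontaineMazurLanglandsGLnPinned_of_crux hE,
    pairCompatibilityAway_of_reciprocityUpToIrreducibility hE, pairCompatibilityAbove_of_crux hPLB hE⟩,
    fun ⟨hW, hFM, hAway, hAbove⟩ => ?_⟩
  have hL : PairCompatibility := by
    intro K _ _
    obtain ⟨Rec, hA⟩ := hAway K
    refine ⟨Rec, fun n hcpt hn π hLa ℓ _ ι ρ hirr hgeo hρ v => ?_⟩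
    by_cases hv : ((ℓ : ℕ) : 𝓞 K) ∈ v.asIdeal
    · exact hAbove K Rec hA n hcpt hn π hLa ℓ ι ρ hirr hgeo hρ v hv
    · exact hA n hcpt hn π hLa ℓ ι ρ hirr hgeo hρ v hv
  exact reciprocityUpToIrreducibility_of (stub_isobaricRigidity hPLB jsPole_of_stubs)
    (stub_geometricConstituents stub_deRhamBlocks) hW
    (stub_weakAutomorphy_of_fontaineMazurLanglandsGLn hFM) hL

/-- **The crux implies the registered open stub `stub_pairCompatibilityAway` (verbatim statement)**:
so LGC-away, like W and B_w, is honestly crux-sized. [cite: DeligneSerreASENS1974, Lemme 3.2] -/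
theorem pairCompatibilityAway_of_crux (hE : ReciprocityUpToIrreducibility) :
    ∀ (K : Type) [Field K] [NumberField K], ∃ Rec : ReciprocityData K,
      ∀ (n : ℕ) (hcpt : isCompact_glFiniteIntegralLevel n K), 0 < n →
        ∀ (π : CuspidalAutomorphicRepData n K hcpt), π.1.IsLAlgebraic →
          ∀ (ℓ : ℕ) [Fact ℓ.Prime] (ι : PadicAlgCl ℓ ≃+* ℂ) (ρ : FramedGaloisRep K (PadicAlgCl ℓ) n),
            ρ.toGaloisRep.IsIrreducible →
            ((∀ᶠ v : HeightOneSpectrum (𝓞 K) in cofinite, ρ.IsUnramifiedAt v) ∧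
              ∀ (v : HeightOneSpectrum (𝓞 K)) (hv : ((ℓ : ℕ) : 𝓞 K) ∈ v.asIdeal),
                (Literature.NumberTheory.PAdicHodge.fontainePstAdicCompletion v ℓ hv).IsDeRhamFramed
                  (ρ.toLocal v)) →
              (∀ᶠ v : HeightOneSpectrum (𝓞 K) in cofinite, SatakeFrobCompatibleAt ι π.1 ρ v) →
                ∀ v : HeightOneSpectrum (𝓞 K), ((ℓ : ℕ) : 𝓞 K) ∉ v.asIdeal →
                  LocalGlobalCompatibleAt Rec ι π.1 ρ v :=
  pairCompatibilityAway_of_reciprocityUpToIrreducibility hE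

/-! ## 1d. Sectors no longer formally blocked after clause (F8) (continuation lead c3)

The disprover's cycle-1 verdict "LGC-above is undecidable for the ε-pinned datum at every instance, even
`ρ = 1`" rested on clauses (F1)–(F7).  With (F8) (Frobenius normalisation of `WD ∘ D_pst` on UNRAMIFIED
representations) the blocked region of `stub_pairCompatibilityAbove` shrinks to the ramified /
non-zero-weight sector, and the de Rham clause of `stub_weakExistence` becomes dischargeable for Tate
twists of unramified representations.  Both facts are landed `--supports` theorems; they are restated here
by name so that the skeleton remains the single map of the line. -/

/-- **Unramified sector of `stub_pairCompatibilityAbove`** (landed registered stub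
`stub_aboveUnramified_of_isWeilDeligneOfLadic`, p121983): under `FontaineDatumExists`, at `v ∣ ℓ` with `ρ`
unramified at `v`, Grothendieck–Deligne data `(π_v, r, rℂ)` for `ρ|_{W_{K_v}}` — the three ℓ-blind
conjuncts of `LocalGlobalCompatibleAt` — witness the `v ∣ ℓ` clause.  So on that sector the stub has
exactly the shape of `stub_pairCompatibilityAway`. [cite: FontaineAsterisque223VIII, §2.3.7] -/
theorem pairCompatibilityAbove_unramifiedSector_of_ladic :
    FontaineDatumExists → ∀ (K : Type) [Field K] [NumberField K] (ℓ : ℕ) [Fact ℓ.Prime] (n : ℕ)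
      (hcpt : isCompact_glFiniteIntegralLevel n K) (Rec : ReciprocityData K) (ι : PadicAlgCl ℓ ≃+* ℂ)
      (π : AutomorphicRepData (AutomorphyDatum.gl n K hcpt)) (ρ : FramedGaloisRep K (PadicAlgCl ℓ) n)
      (v : HeightOneSpectrum (𝓞 K)), ((ℓ : ℕ) : 𝓞 K) ∈ v.asIdeal → ρ.IsUnramifiedAt v →
      ∀ (πv : SmoothIrrep (GL (Fin n) (v.adicCompletion K))), π.HasLocalComponentAt v πv.ρ →
      ∀ (r : WeilDeligneRep (v.adicCompletion K) (PadicAlgCl ℓ) (Fin n → PadicAlgCl ℓ)),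
        IsWeilDeligneOfLadic (ρ.toLocal v).toWeilGroupHom r →
      ∀ (rℂ : WeilDeligneRep (v.adicCompletion K) ℂ (Fin n → ℂ)),
        r.IsTransportAlong (ι : PadicAlgCl ℓ →+* ℂ) rℂ →
        rℂ.HasFrobSemisimpleClass ((Rec.llc v).recGL n (IrrClass.mk πv)) →
        LocalGlobalCompatibleAt Rec ι π ρ v :=
  stub_aboveUnramified_of_isWeilDeligneOfLadic

/-- **The disprover's witness instance is true**: `(π_𝟙, ρ = 1)` is locally–globally compatible at
every `v ∣ ℓ` for every `Rec` (under `FontaineDatumExists`; landed p121983). [cite: FontaineAsterisque223VIII, §1.3] -/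
theorem trivialPair_compatible_above (hF : FontaineDatumExists) {K : Type} [Field K] [NumberField K]
    {hcpt : isCompact_glFiniteIntegralLevel 1 K} {π : AutomorphicRepData (AutomorphyDatum.gl 1 K hcpt)}
    (hW : π.W = Submodule.span ℂ {fun g : (AdelicGroupData.gl 1 K).Adelic =>
      (detTwist 1 (1 : HeckeCharacter K) g : ℂ)})
    (hW' : π.W' = ⊥) (Rec : ReciprocityData K) {ℓ : ℕ} [Fact ℓ.Prime] (ι : PadicAlgCl ℓ ≃+* ℂ)
    (v : HeightOneSpectrum (𝓞 K)) (hv : ((ℓ : ℕ) : 𝓞 K) ∈ v.asIdeal) :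
    LocalGlobalCompatibleAt Rec ι π (1 : FramedGaloisRep K (PadicAlgCl ℓ) 1) v :=
  localGlobalCompatibleAt_trivial_above hF hW hW' Rec ι v hv

/-! ## 1e. The `v ∤ ℓ` clause on the unramified sector and the first witnessed `Corresponds`
(continuation lead c4)

c3's third formal blocker (TameCharacterPlan.md): the Grothendieck–Deligne relation
`IsWeilDeligneOfLadic ρW r` of the summit's `v ∤ ℓ` clause quantifies over a character
`t : I_{K_v} →* E` NON-TRIVIAL on an open subgroup of inertia, and no declaration of the tree produces
one — so no instance of the `v ∤ ℓ` clause of `LocalGlobalCompatibleAt`, hence no instance of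
`Corresponds Rec ι π ρ`, was provable for ANY pair.  c4 supplies the character as a Literature THEOREM
(`WeilGroup.exists_inertiaCharacter_ne_one`, topic GaloisRepresentations: the Kummer characters
`θ_{ℓ^m}` of a uniformiser at a prime `ℓ ≠ p` give an inertia element of infinite order in `I_F^{ab}`
— `exists_mem_absInertia_smul_eq_mul`, `smul_eq_self_of_pow_eq_one_of_mem_absInertia` — and `(E, +)`
is divisible, i.e. an injective `ℤ`-module, Mathlib `Module.Baer.of_divisible`; compactness of `I_F`
moves non-triviality to every open `U ≤ I_F`).  The two registered stubs below isolate what the line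
draws from it, with the character at the place `v` as an explicit hypothesis
`∃ t : I_{K_v} →* Multiplicative ℚ̄_ℓ, ∃ u, t u ≠ 1` (discharged by the Literature theorem in the
glue): the `v ∤ ℓ` twin of c3's `localGlobalCompatibleAt_above_iff_of_isUnramifiedAt`, and the pair
`(π_𝟙, ρ = 1)` CORRESPONDING for every reciprocity datum — the disprover's cycle-1 witness instance of
the crux, now simply true. -/

/-- **LGC-away on the unramified sector is the ℓ-blind matching — unconditionally** (c4; registered
stub `stub_awayUnramified_iff_of_inertiaCharacter` LANDED p124985 `…AwayUnramified.lean`, its character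
hypothesis discharged by the Literature theorem `WeilGroup.exists_inertiaCharacter_ne_one_top`,
p125031 `Literature/…/InertiaCharacter.lean`).  At a place `v ∤ ℓ` where `ρ` is unramified,
`LocalGlobalCompatibleAt Rec ι π ρ v` holds iff some local component `π_v` of `π` at `v` has
`rec_v(π_v)` equal to the Frobenius-semisimple class of a transport of `(ρ|_{W_{K_v}}, N = 0)` along
`ι`. [cite: DeligneAntwerpII1973, §8.4.2] [cite: TateCorvallis1979, (4.1.3)–(4.2.1)] -/
theorem awayUnramified_iff {K : Type} [Field K] [NumberField K] {ℓ : ℕ} [Fact ℓ.Prime] {n : ℕ}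
    {hcpt : isCompact_glFiniteIntegralLevel n K} (Rec : ReciprocityData K) (ι : PadicAlgCl ℓ ≃+* ℂ)
    (π : AutomorphicRepData (AutomorphyDatum.gl n K hcpt)) (ρ : FramedGaloisRep K (PadicAlgCl ℓ) n)
    {v : HeightOneSpectrum (𝓞 K)} (hv : ((ℓ : ℕ) : 𝓞 K) ∉ v.asIdeal) (hρ : ρ.IsUnramifiedAt v) :
    LocalGlobalCompatibleAt Rec ι π ρ v ↔
      ∃ (πv : SmoothIrrep (GL (Fin n) (v.adicCompletion K)))
        (rℂ : WeilDeligneRep (v.adicCompletion K) ℂ (Fin n → ℂ)),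
        π.HasLocalComponentAt v πv.ρ ∧
          (WeilDeligneRep.ofRep ((ρ.toLocal v).weilRestrict (v.adicCompletion K))
            (isLocallyUnramified_toLocal_of_isUnramifiedAt ρ v hρ).isUnramifiedRep_weilRestrict.isContinuousRep).IsTransportAlong
              (ι : PadicAlgCl ℓ →+* ℂ) rℂ ∧
          rℂ.HasFrobSemisimpleClass ((Rec.llc v).recGL n (IrrClass.mk πv)) :=
  stub_awayUnramified_iff_of_inertiaCharacter K ℓ n hcpt Rec ι π ρ v hv hρ
    (WeilGroup.exists_inertiaCharacter_ne_one_top (F := v.adicCompletion K) (PadicAlgCl ℓ))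

/-- **On the unramified-at-`v` sector, local–global compatibility is the ℓ-blind matching at EVERY
finite place** (c3 + c4): under `FontaineDatumExists` (needed only at `v ∣ ℓ`, where the pinned
datum's clause (F8) replaces the Grothendieck–Deligne recipe), for `ρ` unramified at `v` the
summit's `LocalGlobalCompatibleAt Rec ι π ρ v` is equivalent to: some local component `π_v` has
`rec_v(π_v) = [ι(ρ|_{W_{K_v}}, 0)^{F-ss}]`.  So both LGC stubs of the line, restricted to the places
where `ρ` is unramified, are ONE ℓ-blind statement about `rec_v` and Frobenius classes.
[cite: FontaineAsterisque223VIII, §2.3.7] [cite: DeligneAntwerpII1973, §8.4.2] -/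
theorem localGlobalCompatibleAt_iff_of_isUnramifiedAt (hF : FontaineDatumExists) {K : Type} [Field K]
    [NumberField K] {ℓ : ℕ} [Fact ℓ.Prime] {n : ℕ} {hcpt : isCompact_glFiniteIntegralLevel n K}
    (Rec : ReciprocityData K) (ι : PadicAlgCl ℓ ≃+* ℂ)
    (π : AutomorphicRepData (AutomorphyDatum.gl n K hcpt)) (ρ : FramedGaloisRep K (PadicAlgCl ℓ) n)
    {v : HeightOneSpectrum (𝓞 K)} (hρ : ρ.IsUnramifiedAt v) :
    LocalGlobalCompatibleAt Rec ι π ρ v ↔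
      ∃ (πv : SmoothIrrep (GL (Fin n) (v.adicCompletion K)))
        (rℂ : WeilDeligneRep (v.adicCompletion K) ℂ (Fin n → ℂ)),
        π.HasLocalComponentAt v πv.ρ ∧
          (WeilDeligneRep.ofRep ((ρ.toLocal v).weilRestrict (v.adicCompletion K))
            (isLocallyUnramified_toLocal_of_isUnramifiedAt ρ v hρ).isUnramifiedRep_weilRestrict.isContinuousRep).IsTransportAlong
              (ι : PadicAlgCl ℓ →+* ℂ) rℂ ∧
          rℂ.HasFrobSemisimpleClass ((Rec.llc v).recGL n (IrrClass.mk πv)) := by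
  by_cases hv : ((ℓ : ℕ) : 𝓞 K) ∈ v.asIdeal
  · exact localGlobalCompatibleAt_above_iff_of_isUnramifiedAt hF Rec ι π ρ hv hρ
  · exact awayUnramified_iff Rec ι π ρ hv hρ

/-- **`(π_𝟙, 1)` corresponds, for EVERY reciprocity datum — unconditionally in the character**
(c4; registered stub `stub_trivialPair_corresponds_of_inertiaCharacter` LANDED p125159
`…TrivialPairCorresponds.lean`, its character hypothesis discharged by
`WeilGroup.exists_inertiaCharacter_ne_one_top`, p125031).  Under `FontaineDatumExists` (needed at
`v ∣ ℓ` only), for the trivial automorphic character `π_𝟙 = ℂ·(1 ∘ det)/⊥` of `GL₁(𝔸_K)`: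
`Corresponds Rec ι π_𝟙 1`.  This is the disprover's cycle-1 witness instance of the crux
(`Negative/PinnedFontaineDatumUndecided`, `Negative/TrivialCharacterLocalGlobal`): no longer
undecidable, simply true. [cite: TateCorvallis1979, (4.1.3)–(4.2.1)] [cite: FontaineAsterisque223VIII, §1.3] -/
theorem trivialPair_corresponds (hF : FontaineDatumExists) {K : Type} [Field K] [NumberField K]
    {ℓ : ℕ} [Fact ℓ.Prime] {hcpt : isCompact_glFiniteIntegralLevel 1 K}
    {π : AutomorphicRepData (AutomorphyDatum.gl 1 K hcpt)}
    (hW : π.W = Submodule.span ℂ {fun g : (AdelicGroupData.gl 1 K).Adelic =>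
      (detTwist 1 (1 : HeckeCharacter K) g : ℂ)})
    (hW' : π.W' = ⊥) (Rec : ReciprocityData K) (ι : PadicAlgCl ℓ ≃+* ℂ) :
    Corresponds Rec ι π (1 : FramedGaloisRep K (PadicAlgCl ℓ) 1) :=
  stub_trivialPair_corresponds_of_inertiaCharacter hF K ℓ hcpt Rec ι π hW hW' fun v _ =>
    WeilGroup.exists_inertiaCharacter_ne_one_top (F := v.adicCompletion K) (PadicAlgCl ℓ)

/-- **The summit's correspondence predicate is satisfiable, for every reciprocity datum** (c4):
under `FontaineDatumExists`, for every number field `K`, every `Rec : ReciprocityData K`, every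
`ℓ`, `ι` and every finiteness witness `hcpt` in rank `1`, there are an L-algebraic CUSPIDAL `π` of
`GL₁(𝔸_K)` and a geometric `ρ : Γ_K → GL₁(ℚ̄_ℓ)` with `Corresponds Rec ι π ρ` — namely `(π_𝟙, 1)`
(`exists_trivial_cuspidal`; `1` is unramified everywhere, hence pinned-geometric).  So direction (A)
of the crux in rank one is witnessed at its first instance for EVERY `Rec`; before c4 no instance of
`Corresponds` was provable for any pair (c3's blocker B3). [cite: BuzzardGeeLMS2014, Conj. 3.2.1]
[cite: TateCorvallis1979, (4.2.1)] -/
theorem exists_corresponds (hF : FontaineDatumExists) (K : Type) [Field K] [NumberField K]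
    (Rec : ReciprocityData K) (ℓ : ℕ) [Fact ℓ.Prime] (ι : PadicAlgCl ℓ ≃+* ℂ)
    (hcpt : isCompact_glFiniteIntegralLevel 1 K) :
    ∃ (π : CuspidalAutomorphicRepData 1 K hcpt) (ρ : FramedGaloisRep K (PadicAlgCl ℓ) 1),
      π.1.IsLAlgebraic ∧ IsGeometricFramed Rec ρ ∧ Corresponds Rec ι π.1 ρ := by
  obtain ⟨π, hW, hW', hL, -⟩ := Negative.exists_trivial_cuspidal (K := K) hcpt
  exact ⟨π, 1, hL, isGeometricFramed_of_forall_isUnramifiedAt Rec 1 fun _ _ _ _ _ => rfl,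
    trivialPair_corresponds hF hW hW' Rec ι⟩

/-! ## 1f. Rank one: local–global compatibility at the unramified places of a Hecke character,
for EVERY reciprocity datum (continuation lead c4, wave 2)

With §1e the `v ∤ ℓ` and `v ∣ ℓ` clauses on the unramified sector are ONE ℓ-blind matching
`rec_v(π_v) = [ι(ρ|_{W_{K_v}}, 0)^{F-ss}]`.  In rank one the matching is decidable for every
`Rec` at the places where the Hecke character `χ` of `π` is unramified: `rec_v = rec₁` is local
class field theory for ANY local Langlands datum (`IsLocalLanglandsGL.rec_one_mk`: `rec_v(χ_v) =
[(χ_v ∘ artin_v, 0)]`), `artin_v` sends geometric Frobenii to uniformisers (Deligne's normalisation,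
`LocalArtinData.artin_frob`) and inertia into `𝒪_vˣ` (`image_inertia`), while a rank-one `ρ`
unramified at `v` with `char(Frob_v^{arith}) = X - ι⁻¹(χ(ϖ_v))⁻¹` (the Satake clause) has
`ι ρ(Φ) = χ(ϖ_v)` on geometric Frobenii `Φ` (`trace_toLocal_eq_of_isUnramifiedAt_of_hasFrobCharpolyAt`).
At the RAMIFIED places of `χ` nothing can be proved for an arbitrary `Rec`: the tree's
`LocalArtinData` is not unique on `𝒪_vˣ` (module docstring of `LocalGalois`, "lang.S08 has no ∃!"),
so `rec_v(χ_v) = χ_v ∘ artin_v` need not be the restriction of the global avatar — the summit's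
`∃ Rec` is essential there (blocker B2).  Registered stubs (workers): the local matching and the
local component; the lead assembles. -/

/- LANDED (c4 wave 2): registered stub `stub_rankOne_unramified_recGL_matching` — p125431
`Theorems/…ReciprocityUpToIrreducibilityRankOneMatching.lean` (imported; same namespace): for any local
Langlands datum `L`, an unramified quasi-character `χ` and `r` on `ℂ¹` with `N = 0`, unramified `r.ρ`
and `r.ρ(Φ) = χ(artin Φ) • id` for one geometric Frobenius, `r ∈ rec₁[χ ∘ det]`. -/

/- LANDED (c4 wave 2): registered stub `stub_rankOne_hasLocalComponentAt_of_isUnramifiedAt` — p125557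
`Theorems/…ReciprocityUpToIrreducibilityRankOneLocalComponent.lean` (imported; same namespace): a `GL₁`
datum with Hecke character `χ` has, at every place where `χ` is unramified, the local component
`χ_v ∘ det` with `χ_v` a quasi-character of `K_vˣ` trivial on `𝒪_vˣ`. -/

/- LANDED (c4 wave 2, assembly by the lead): registered stub
`stub_rankOne_localGlobalCompatibleAt_of_satakeFrobCompatibleAt` — p125744
`Theorems/…ReciprocityUpToIrreducibilityRankOneUnramified.lean` (imported; same namespace), with
`rankOne_transport_frobenius`, `rankOne_matching_of_satakeFrobCompatibleAt`,
`rankOne_corresponds_of_bad_places`. -/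

/-- **Rank one, every `Rec`: local–global compatibility at the good places** (c4 wave 2, all three
registered stubs landed).  Under `FontaineDatumExists` (used at `v ∣ ℓ` only): if `GL₁(𝔸_K)` acts on
`π` through the Hecke character `χ ∘ det`, `χ` is unramified at `v` and `ρ : Γ_K → GL₁(ℚ̄_ℓ)` is
Satake–Frobenius compatible with `π` at `v`, then `LocalGlobalCompatibleAt Rec ι π ρ v` for EVERY
reciprocity datum `Rec`.  This is the whole content of the two LGC stubs of the line in rank one
outside the ramified places of `χ` — where the non-uniqueness of the tree's `LocalArtinData`
(blocker B2) makes the clause depend on `Rec`. [cite: BuzzardGeeLMS2014, Conj. 3.2.1–3.2.2 (n = 1)]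
[cite: TateCorvallis1979, (4.2.1)] [cite: HarrisTaylorAMS2001, Thm. A (i)] -/
theorem rankOne_localGlobalCompatibleAt_goodPlaces (hF : FontaineDatumExists) {K : Type} [Field K]
    [NumberField K] {ℓ : ℕ} [Fact ℓ.Prime] {hcpt : isCompact_glFiniteIntegralLevel 1 K}
    (Rec : ReciprocityData K) (ι : PadicAlgCl ℓ ≃+* ℂ)
    (π : AutomorphicRepData (AutomorphyDatum.gl 1 K hcpt)) (χ : HeckeCharacter K)
    (hχ : ∀ (g : (AdelicGroupData.gl 1 K).Adelic), ∀ φ ∈ π.W,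
      rightTranslation (AdelicGroupData.gl 1 K) g φ -
        ((χ (Matrix.GeneralLinearGroup.det g) : ℂˣ) : ℂ) • φ ∈ π.W')
    (ρ : FramedGaloisRep K (PadicAlgCl ℓ) 1) {v : HeightOneSpectrum (𝓞 K)} (hur : χ.IsUnramifiedAt v)
    (hsat : SatakeFrobCompatibleAt ι π ρ v) : LocalGlobalCompatibleAt Rec ι π ρ v :=
  stub_rankOne_localGlobalCompatibleAt_of_satakeFrobCompatibleAt hF K ℓ hcpt Rec ι π χ hχ ρ v hur hsat

/-- **Rank one, every `Rec`: `Corresponds` is local–global compatibility at the bad places** (c4).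
For `π` with Hecke character `χ` and `ρ` Satake–Frobenius compatible a.e., `Corresponds Rec ι π ρ`
follows from LGC at the places where `χ` is ramified or `ρ` is not Satake–Frobenius compatible with
`π` — the exact residue of `stub_pairCompatibilityAway`/`…Above` in rank one, and the region of
blocker B2. [cite: BuzzardGeeLMS2014, Conj. 3.2.1–3.2.2 (n = 1)] -/
theorem rankOne_corresponds_of_badPlaces (hF : FontaineDatumExists) {K : Type} [Field K]
    [NumberField K] {ℓ : ℕ} [Fact ℓ.Prime] {hcpt : isCompact_glFiniteIntegralLevel 1 K}
    (Rec : ReciprocityData K) (ι : PadicAlgCl ℓ ≃+* ℂ)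
    (π : AutomorphicRepData (AutomorphyDatum.gl 1 K hcpt)) (χ : HeckeCharacter K)
    (hχ : ∀ (g : (AdelicGroupData.gl 1 K).Adelic), ∀ φ ∈ π.W,
      rightTranslation (AdelicGroupData.gl 1 K) g φ -
        ((χ (Matrix.GeneralLinearGroup.det g) : ℂˣ) : ℂ) • φ ∈ π.W')
    (ρ : FramedGaloisRep K (PadicAlgCl ℓ) 1)
    (hae : ∀ᶠ v : HeightOneSpectrum (𝓞 K) in cofinite, SatakeFrobCompatibleAt ι π ρ v)
    (hbad : ∀ v : HeightOneSpectrum (𝓞 K), ¬ (χ.IsUnramifiedAt v ∧ SatakeFrobCompatibleAt ι π ρ v) →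
      LocalGlobalCompatibleAt Rec ι π ρ v) :
    Corresponds Rec ι π ρ :=
  rankOne_corresponds_of_bad_places hF Rec ι π χ hχ ρ hae hbad

/-! ## 1h. Rank `n`: the unramified matching for EVERY reciprocity datum (continuation lead c5,
wave N4)

§1e reduced both local–global stubs, on the unramified-at-`v` sector, to the ℓ-blind matching
`rec_v(π_v) = [ι(ρ|_{W_{K_v}}, 0)^{F-ss}]`; §1f settled it in rank one.  In rank `n`, at a place `v`
where `π` has Satake parameter `α`, `ρ` is unramified and `char(ρ(Frob_v^{arith})) = ∏ (X - ι⁻¹(a⁻¹))`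
(`SatakeFrobCompatibleAt`), the matching splits into three registered stubs and a formal assembly:
(H1) UNIQUENESS — two Frobenius-semisimple unramified `N = 0` Weil–Deligne representations on `ℂⁿ`
with the same characteristic polynomial of a geometric Frobenius are isomorphic (Brauer–Nesbitt);
(H2) GALOIS SIDE — every transport `rℂ` of `(ρ|_{W_{K_v}}, 0)` along `ι` has `N = 0`, is unramified,
and its geometric Frobenii have characteristic polynomial `∏_{a ∈ α} (X - a)`; (H3) AUTOMORPHIC SIDE —
every Frobenius-semisimple representative of `rec_v(π_v)` (`π_v` a local component of the cuspidal
`π`) has `N = 0`, is unramified, with the same characteristic polynomial: for `GL₂` a THEOREM of the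
tree (clause (iii-L) of the datum + the spherical zeta integral,
`WeilDeligneRep.unramified_of_hasFrobSemisimpleClass_recGL_of_isSatakeParameter`), for `GL_n` modulo
the Jacquet–Shalika unramified computation (named fact `hasRSLFactor_of_isSatakeParameter_haar` at
`(n, 1)`).  Assembly (lead): the Frobenius-semisimplification `r'` of `rℂ`
(`WeilDeligneRep.exists_isFrobSemisimplificationOf`) keeps `N = 0`, the inertia action and — a
commuting nilpotent perturbation — the characteristic polynomial of `Φ`, so (H1) applied to `r'` and a
representative of `rec_v(π_v)` gives `rℂ.HasFrobSemisimpleClass (rec_v(π_v))`, and §1e concludes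
`LocalGlobalCompatibleAt Rec ι π ρ v` for EVERY `Rec`. -/

/- LANDED (c5 wave 1, all four ACCEPTED, imported above, same namespace):
  registered stub H1 `stub_wdUnramified_isEquivalent_of_charpoly_eq` — p127316
    `Theorems/…ReciprocityUpToIrreducibilityWDUnramifiedUniqueness.lean` (Brauer–Nesbitt for the monoid ℕ on
    `k ↦ ρᵢ(Φ)ᵏ`, helper `exists_linearEquiv_conj_of_isSemisimple_of_charpoly_eq_wdH1`);
  registered stub H2 `stub_transport_frobCharpoly` — p127278 `Theorems/…ReciprocityUpToIrreducibilityTransportFrobCharpoly.lean`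
    (open form `transport_frobCharpoly`, `charpoly_toLocal_of_isFrobPow_neg_one`);
  registered stub H3 `stub_recGL_two_unramified` — p127348 `Theorems/…ReciprocityUpToIrreducibilityRecGLTwoUnramified.lean`
    (Carayol local deduction; helpers `isUnramifiedRep_apply_eq_of_deg_eq_recGLTwoUnramified`,
    `charpoly_fin_two_of_charpolyRev_recGLTwoUnramified`);
  registered stub H4 `stub_recGL_unramified_of_unramifiedComputation` — p127491
    `Theorems/…ReciprocityUpToIrreducibilityRecGLUnramified.lean` (rank-`n` redo of the Carayol deduction modulo
    the named fact `hasRSLFactor_of_isSatakeParameter_haar` at `(n,1)`; local form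
    `recGL_unramified_of_isSatakeParameter_of_unramifiedComputation_recGLn` for any `LocalLanglandsDatum`). -/

/-! ## 1i. Assembly of wave N4 (continuation lead c5): `GL₂` — Satake-compatible ⇒ locally–globally
compatible, for EVERY `Rec`; `GL_n` modulo the Jacquet–Shalika unramified computation

Landed as `Theorems/…ReciprocityUpToIrreducibilityUnramifiedMatching.lean` (lead, --supports):
`exists_frobSemisimplification_unramified`, `hasFrobSemisimpleClass_of_unramified_charpoly` (the formal
matching from H1), `rankTwo_matching_of_satakeFrobCompatibleAt`,
`rankTwo_localGlobalCompatibleAt_of_satakeFrobCompatibleAt`, `rankTwo_corresponds_of_badPlaces`,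
`rankTwo_pairCompatibility_satakeSector`, `localGlobalCompatibleAt_of_satakeFrobCompatibleAt_of_unramifiedComputation`,
`corresponds_of_badPlaces_of_unramifiedComputation`.  Restated here by name (skeleton = the single map of
the line). -/

/-- **`GL₂`, every `Rec`: local–global compatibility at every Satake-compatible place** (c5; under
`FontaineDatumExists` at `v ∣ ℓ` only).  For `π` cuspidal on `GL₂(𝔸_K)`, `ρ : Γ_K → GL₂(ℚ̄_ℓ)` and a
finite `v` with `SatakeFrobCompatibleAt ι π ρ v`: `LocalGlobalCompatibleAt Rec ι π ρ v` — both local–global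
stubs of the line hold in rank two, for every `Rec`, off the finitely many non-Satake places of any
a.e.-compatible pair (the residue = blockers B1/B2). [cite: BuzzardGeeLMS2014, Conj. 3.2.1–3.2.2]
[cite: HarrisTaylorAMS2001, Thm. A (ii), (v)] [cite: TateCorvallis1979, (4.1.3)–(4.2.1)] -/
theorem rankTwo_localGlobalCompatibleAt_goodPlaces (hF : FontaineDatumExists) {K : Type} [Field K]
    [NumberField K] {ℓ : ℕ} [Fact ℓ.Prime] {hcpt : isCompact_glFiniteIntegralLevel 2 K}
    (Rec : ReciprocityData K) (ι : PadicAlgCl ℓ ≃+* ℂ) (π : CuspidalAutomorphicRepData 2 K hcpt)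
    (ρ : FramedGaloisRep K (PadicAlgCl ℓ) 2) {v : HeightOneSpectrum (𝓞 K)}
    (hsat : SatakeFrobCompatibleAt ι π.1 ρ v) : LocalGlobalCompatibleAt Rec ι π.1 ρ v :=
  rankTwo_localGlobalCompatibleAt_of_satakeFrobCompatibleAt hF Rec ι π ρ hsat

/-- **`GL₂`, every `Rec`: `Corresponds` is local–global compatibility at the bad places** (c5).
[cite: BuzzardGeeLMS2014, Conj. 3.2.1–3.2.2] -/
theorem rankTwo_corresponds_of_bad_places (hF : FontaineDatumExists) {K : Type} [Field K]
    [NumberField K] {ℓ : ℕ} [Fact ℓ.Prime] {hcpt : isCompact_glFiniteIntegralLevel 2 K}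
    (Rec : ReciprocityData K) (ι : PadicAlgCl ℓ ≃+* ℂ) (π : CuspidalAutomorphicRepData 2 K hcpt)
    (ρ : FramedGaloisRep K (PadicAlgCl ℓ) 2)
    (hae : ∀ᶠ v : HeightOneSpectrum (𝓞 K) in cofinite, SatakeFrobCompatibleAt ι π.1 ρ v)
    (hbad : ∀ v : HeightOneSpectrum (𝓞 K), ¬ SatakeFrobCompatibleAt ι π.1 ρ v →
      LocalGlobalCompatibleAt Rec ι π.1 ρ v) :
    Corresponds Rec ι π.1 ρ :=
  rankTwo_corresponds_of_badPlaces hF Rec ι π ρ hae hbad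

/-! ## 1j. The Hilbert-modular sector of direction (A) (continuation lead c5, wave 2)

Direction (A) of the crux — WITH irreducibility and uniqueness, i.e. the body of the SUMMIT's
`AutomorphicToGalois 2 Rec hcpt` — for cuspidal `π` on `GL₂` over a totally real field that are
L-algebraic with a REGULAR infinity type (cuspidal Hilbert eigenforms of paritious weight `k_σ ≥ 2` up
to the half-twist), conditional on three published theorems stated as named facts of the tree:
lang.S27 `exists_galoisRep_of_regularAlgebraic` (Carayol–Taylor–Blasius–Rogawski for `n = 2`),
`galoisRep_GL2_totallyReal_irreducible` (Ribet; Skinner 2009 §2.4.2) and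
`galoisRep_GL2_totallyReal_localGlobal` (Carayol 1986 / Saito / Skinner 2009: local–global compatibility at
EVERY finite place in the summit's pinned vocabulary, ONE family `llc` of local Langlands data per field).
The non-regular (partial weight one) `π` are exactly the catalogued barrier
`Literature/Barriers/Langlands/NonRegularWeightBarrier`.  LANDED (wave 2): registered stub
`stub_hilbert_automorphicToGalois` — p127779 `Theorems/…ReciprocityUpToIrreducibilityHilbertSector.lean`
(imported; 8 lines of glue on `exists_irreducible_satakeFrobCompatibleAE_GL2` + the local–global fact +
c2's `isConjugate_of_satakeFrobCompatibleAt`). -/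

/-- **Direction (A) of the summit on the Hilbert-modular sector, modulo three named facts** (c5 wave 2,
registered stub `stub_hilbert_automorphicToGalois`, landed p127779): for `K` totally real there is ONE
reciprocity datum `Rec` such that every cuspidal `π` on `GL₂(𝔸_K)`, L-algebraic with a regular infinity
type, has for all `ℓ`, `ι` an irreducible pinned-geometric `ρ : Γ_K → GL₂(ℚ̄_ℓ)` with `Corresponds Rec ι π ρ`
(Satake–Frobenius a.e. + local–global compatibility at EVERY finite place), unique up to conjugacy.
[cite: CarayolASENS1986, Thm. (A)] [cite: Skinner2009, Thm. 1 and §2.4.2] [cite: BuzzardGeeLMS2014, Conj. 3.2.1–3.2.2 and §5.3] -/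
theorem hilbert_automorphicToGalois (h27 : exists_galoisRep_of_regularAlgebraic)
    (hirr : galoisRep_GL2_totallyReal_irreducible) (hLG : galoisRep_GL2_totallyReal_localGlobal)
    (K : Type) [Field K] [NumberField K] (hK : NumberField.IsTotallyReal K) :
    ∃ Rec : ReciprocityData K,
      ∀ (hcpt : isCompact_glFiniteIntegralLevel 2 K) (π : CuspidalAutomorphicRepData 2 K hcpt),
        π.1.IsLAlgebraic → (∃ T : InfinityType K 2, π.1.HasInfinityType T ∧ T.IsRegular) →
        ∀ (ℓ : ℕ) [Fact ℓ.Prime] (ι : PadicAlgCl ℓ ≃+* ℂ),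
          ∃ ρ : FramedGaloisRep K (PadicAlgCl ℓ) 2,
            ρ.toGaloisRep.IsIrreducible ∧ IsGeometricFramed Rec ρ ∧ Corresponds Rec ι π.1 ρ ∧
              ∀ ρ' : FramedGaloisRep K (PadicAlgCl ℓ) 2, Corresponds Rec ι π.1 ρ' → IsConjugate ρ ρ' :=
  stub_hilbert_automorphicToGalois h27 hirr hLG K hK

/-- **… hence the crux's direction (A') (no irreducibility, no uniqueness) AND the summit's full (A) hold
verbatim on that sector**: with the `Rec` of `hilbert_automorphicToGalois`, every regular L-algebraic
cuspidal `π` on `GL₂` over a totally real `K` has SOME pinned-geometric `ρ` with `Corresponds Rec ι π ρ`.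
[cite: BuzzardGeeLMS2014, Conj. 3.2.1–3.2.2] -/
theorem hilbert_weakReciprocity_A (h27 : exists_galoisRep_of_regularAlgebraic)
    (hirr : galoisRep_GL2_totallyReal_irreducible) (hLG : galoisRep_GL2_totallyReal_localGlobal)
    (K : Type) [Field K] [NumberField K] (hK : NumberField.IsTotallyReal K) :
    ∃ Rec : ReciprocityData K,
      ∀ (hcpt : isCompact_glFiniteIntegralLevel 2 K) (π : CuspidalAutomorphicRepData 2 K hcpt),
        π.1.IsLAlgebraic → (∃ T : InfinityType K 2, π.1.HasInfinityType T ∧ T.IsRegular) →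
        ∀ (ℓ : ℕ) [Fact ℓ.Prime] (ι : PadicAlgCl ℓ ≃+* ℂ),
          ∃ ρ : FramedGaloisRep K (PadicAlgCl ℓ) 2, IsGeometricFramed Rec ρ ∧ Corresponds Rec ι π.1 ρ := by
  obtain ⟨Rec, hRec⟩ := hilbert_automorphicToGalois h27 hirr hLG K hK
  refine ⟨Rec, fun hcpt π hL hreg ℓ _ ι => ?_⟩
  obtain ⟨ρ, -, hgeo, hcorr, -⟩ := hRec hcpt π hL hreg ℓ ι
  exact ⟨ρ, hgeo, hcorr⟩

/-! ## 1k. The converse on the unramified sector (continuation lead c5, waves 3–4): local–global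
compatibility at a place where `π` is unramified FORCES Satake–Frobenius compatibility.
ALL FOUR registered stubs are LANDED and imported by name (C2 `stub_rankTwo_satake_of_localGlobal_away`
p128294 `…RankTwoConverseAway.lean`, Cn `stub_isUnramifiedAt_and_hasFrobCharpolyAt_of_weilDeligne` p128418
`…WeilDeligneBridge.lean`, C2-iff `stub_rankTwo_localGlobalCompatibleAt_iff_away` p128904
`…UnramifiedMatchingConverse.lean`, C2-above `stub_rankTwo_satake_of_localGlobal_above_of_isUnramifiedAt` p128853
`…RankTwoConverseAbove.lean`; c6 replaced c5's olean-lag sorries by the imports).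

With §1i this makes the summit's clause an EQUIVALENCE for `GL₂` at `v ∤ ℓ`, `π_v` unramified, every
`Rec`: `LocalGlobalCompatibleAt Rec ι π ρ v ↔ SatakeFrobCompatibleAt ι π ρ v`.  (At `v ∣ ℓ` the clause says
"crystalline", not "unramified": the converse there needs `ρ` unramified at `v`.) -/

/-- **`GL₂`, `v ∤ ℓ`, `π_v` unramified, every `Rec`: the local–global clause IS Satake–Frobenius
compatibility** (c5 stubs C2 + C2-iff, landed p128294 / p128904). [cite: CarayolASENS1986, Thm. (A)]
[cite: BuzzardGeeLMS2014, Conj. 3.2.1–3.2.2] -/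
theorem rankTwo_localGlobal_iff_satake_away {K : Type} [Field K] [NumberField K] {ℓ : ℕ} [Fact ℓ.Prime]
    {hcpt : isCompact_glFiniteIntegralLevel 2 K} (Rec : ReciprocityData K) (ι : PadicAlgCl ℓ ≃+* ℂ)
    (π : CuspidalAutomorphicRepData 2 K hcpt) (ρ : FramedGaloisRep K (PadicAlgCl ℓ) 2)
    {v : HeightOneSpectrum (𝓞 K)} (hv : ((ℓ : ℕ) : 𝓞 K) ∉ v.asIdeal) (hπv : π.1.IsUnramifiedAt v) :
    LocalGlobalCompatibleAt Rec ι π.1 ρ v ↔ SatakeFrobCompatibleAt ι π.1 ρ v :=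
  stub_rankTwo_localGlobalCompatibleAt_iff_away K ℓ hcpt Rec ι π ρ v hv hπv

/-- **`GL₂`, `v ∣ ℓ`, `ρ` and `π` unramified at `v`, every `Rec`: the clause IS Satake–Frobenius
compatibility** (`→` c5 stub C2-above p128853 under `FontaineDatumExists`; `←` wave N4 §1i).
[cite: FontaineAsterisque223VIII, §2.3.7] [cite: BuzzardGeeLMS2014, Conj. 3.2.1–3.2.2] -/
theorem rankTwo_localGlobal_iff_satake_above_of_isUnramifiedAt (hF : FontaineDatumExists) {K : Type}
    [Field K] [NumberField K] {ℓ : ℕ} [Fact ℓ.Prime] {hcpt : isCompact_glFiniteIntegralLevel 2 K}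
    (Rec : ReciprocityData K) (ι : PadicAlgCl ℓ ≃+* ℂ) (π : CuspidalAutomorphicRepData 2 K hcpt)
    (ρ : FramedGaloisRep K (PadicAlgCl ℓ) 2) {v : HeightOneSpectrum (𝓞 K)}
    (hv : ((ℓ : ℕ) : 𝓞 K) ∈ v.asIdeal) (hρ : ρ.IsUnramifiedAt v) (hπv : π.1.IsUnramifiedAt v) :
    LocalGlobalCompatibleAt Rec ι π.1 ρ v ↔ SatakeFrobCompatibleAt ι π.1 ρ v :=
  ⟨stub_rankTwo_satake_of_localGlobal_above_of_isUnramifiedAt hF K ℓ hcpt Rec ι π ρ v hv hρ hπv,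
    rankTwo_localGlobalCompatibleAt_of_satakeFrobCompatibleAt hF Rec ι π ρ⟩

/-! ## 1l. Rank `n`: the unramified matching WITHOUT the Jacquet–Shalika named fact
(continuation lead c6, wave N6')

§1h–§1k hold for `GL_n`, `n ≥ 3`, only modulo the named fact `hasRSLFactor_of_isSatakeParameter_haar`
at `(n, 1)` (the full unramified computation `L(s, π_v × 1) = ∏ (1 - a q^{-s})⁻¹` in the sense of
`HasRSLFactor`, whose clause (a) for ALL test vectors needs Jacquet-module finiteness on `GL_n`).  The
matching needs LESS: clause (iii-L) of the local Langlands datum already provides THE `L`-polynomial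
`P = det(1 - TΦ | (rec π_v ⊗ rec 1)^{I, N = 0})` of `(π_v, 1)`, of degree `≤ n`
(`natDegree_eulerFactor_le`); so the DIVISIBILITY `∏_{a ∈ α} (1 - a T) ∣ P` — read off ONE spherical
test vector — together with `deg P ≤ n = #α` (all `a ≠ 0`) and `P(0) = 1` gives `P = ∏ (1 - a T)`,
and H4's degree argument runs unconditionally.  The divisibility is the `GL_n × GL₁` case of
Jacquet–Shalika 1981 §2 / Cogdell 2004 Thm. 3.3 for the spherical vector, and everything it needs is
in the tree for `GL_n`: the corner torus sum `hasSum_whittakerModel_cornerTorus` (Shintani's formula +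
Cauchy, `m ≤ n`), `W°(1) ≠ 0` (`exists_spherical_whittaker_ne_zero_of_isSatakeParameter`), the shell
decomposition `integral_units_eq_tsum_shell`, the `(n,1)` kernel `rsKernel_mk_of_fin_one`, and the
comparison `dvd_of_eval_mul_eq_const`; only the `GL₂`-specific glue of `GL2UnramifiedLFactorDivisibility`
/ `GL2RSLFactorUnramified` (`diagGL2`, `unipotentGL2`) had to be redone on the corner
`glCorner F (1 ≤ n) (GL₁)`.  ALL FIVE registered stubs of the wave are LANDED and imported by name
(same namespace):
  S1 `stub_rsZeta_fin_one_eq_integral_corner` — p129975 `Theorems/…ReciprocityUpToIrreducibilityCornerZetaIntegral.lean`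
     (the `(n,1)` zeta integral against a constant `W'` is the corner-torus integral over `Fˣ`);
  S2 `stub_spherical_whittaker_corner` — p130274 `Theorems/…SphericalWhittakerCorner.lean` (spherical
     Whittaker function on the corner: zero beyond the conductor, `𝒪ˣ`-invariant; helpers
     `glCorner_glDiagonal_fin_one_eq_diagonalGL`, `whittakerModel_transvectionGL_glCorner`);
  S3 `stub_whittaker_corner_diagonal_comm` — p130383 `Theorems/…CornerDiagonalComm.lean` (diagonal
     conjugation on the corner; `dual_comp_rep_ne_zero`);
  S4 `stub_rsZeta_spherical_trivial_eq` — p130557 `Theorems/…SphericalZetaGLn.lean` (lead: the spherical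
     `(n,1)` computation `Ψ(s; W_v, Λ'(v')) = μ'(𝒪ˣ) Λ(v) Λ'(v') / ∏ (1 - a q^{-s})`);
  S7' `stub_recGL_unramified_of_dvd` — p130449 `Theorems/…RecGLUnramifiedOfDvd.lean` (the local deduction
     from divisibility: H4 with `=` replaced by `∣` + degree).
ASSEMBLY (lead) `Theorems/…ReciprocityUpToIrreducibilityUnramifiedMatchingGLn.lean`:
`prod_one_sub_C_mul_X_dvd_of_hasRSLFactor_gl` (the `GL_n × GL₁` divisibility for every `ψ`, every
invariant `ν`), `recGL_unramified_of_isSatakeParameter_gl` / `recGL_unramified_of_hasSatakeParamAt`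
(stub H4 WITHOUT `hJS`), and c5's matching theorems with the Jacquet–Shalika hypothesis DISCHARGED —
restated below by name. -/

/-- **`GL_n` (`2 ≤ n`), EVERY `Rec`: local–global compatibility at every Satake-compatible place, with
NO named fact but `FontaineDatumExists` (at `v ∣ ℓ`)** (c6 assembly
`localGlobalCompatibleAt_of_satakeFrobCompatibleAt`).  For `π` cuspidal on `GL_n(𝔸_K)`,
`ρ : Γ_K → GL_n(ℚ̄_ℓ)` and a finite `v` with `SatakeFrobCompatibleAt ι π ρ v`:
`LocalGlobalCompatibleAt Rec ι π ρ v` — both local–global stubs of the line hold in every rank, for every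
`Rec`, off the finitely many non-Satake places of any a.e.-compatible pair (the residue = blockers B1/B2).
[cite: BuzzardGeeLMS2014, Conj. 3.2.1–3.2.2] [cite: HarrisTaylorAMS2001, Thm. A (ii), (v)]
[cite: JacquetShalika1981, §2] [cite: TateCorvallis1979, (4.1.3)–(4.2.1)] -/
theorem rankN_localGlobalCompatibleAt_goodPlaces (hF : FontaineDatumExists) {K : Type} [Field K]
    [NumberField K] {ℓ : ℕ} [Fact ℓ.Prime] {n : ℕ} (hn : 1 < n) {hcpt : isCompact_glFiniteIntegralLevel n K}
    (Rec : ReciprocityData K) (ι : PadicAlgCl ℓ ≃+* ℂ) (π : CuspidalAutomorphicRepData n K hcpt)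
    (ρ : FramedGaloisRep K (PadicAlgCl ℓ) n) {v : HeightOneSpectrum (𝓞 K)}
    (hsat : SatakeFrobCompatibleAt ι π.1 ρ v) : LocalGlobalCompatibleAt Rec ι π.1 ρ v :=
  localGlobalCompatibleAt_of_satakeFrobCompatibleAt hF hn Rec ι π ρ hsat

/-- **`GL_n`, every `Rec`: `Corresponds` is local–global compatibility at the bad places**, no named fact
but `FontaineDatumExists` (c6 assembly `corresponds_of_badPlaces`). [cite: BuzzardGeeLMS2014, Conj. 3.2.1–3.2.2] -/
theorem rankN_corresponds_of_badPlaces (hF : FontaineDatumExists) {K : Type} [Field K] [NumberField K]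
    {ℓ : ℕ} [Fact ℓ.Prime] {n : ℕ} (hn : 1 < n) {hcpt : isCompact_glFiniteIntegralLevel n K}
    (Rec : ReciprocityData K) (ι : PadicAlgCl ℓ ≃+* ℂ) (π : CuspidalAutomorphicRepData n K hcpt)
    (ρ : FramedGaloisRep K (PadicAlgCl ℓ) n)
    (hae : ∀ᶠ v : HeightOneSpectrum (𝓞 K) in cofinite, SatakeFrobCompatibleAt ι π.1 ρ v)
    (hbad : ∀ v : HeightOneSpectrum (𝓞 K), ¬ SatakeFrobCompatibleAt ι π.1 ρ v →
      LocalGlobalCompatibleAt Rec ι π.1 ρ v) :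
    Corresponds Rec ι π.1 ρ :=
  corresponds_of_badPlaces hF hn Rec ι π ρ hae hbad

/-- **`GL_n`, every `Rec`, `v ∤ ℓ`, `π_v` unramified: the summit's clause IS the Satake clause**
(c6 assembly `localGlobalCompatibleAt_iff_satakeFrobCompatibleAt_away`; no named fact — `FontaineDatumExists`
is idle at `v ∤ ℓ`). [cite: BuzzardGeeLMS2014, Conj. 3.2.1–3.2.2] [cite: TateCorvallis1979, (4.1.6)–(4.2.1)] -/
theorem rankN_localGlobal_iff_satake_away (hF : FontaineDatumExists) {K : Type} [Field K] [NumberField K]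
    {ℓ : ℕ} [Fact ℓ.Prime] {n : ℕ} (hn : 1 < n) {hcpt : isCompact_glFiniteIntegralLevel n K}
    (Rec : ReciprocityData K) (ι : PadicAlgCl ℓ ≃+* ℂ) (π : CuspidalAutomorphicRepData n K hcpt)
    (ρ : FramedGaloisRep K (PadicAlgCl ℓ) n) {v : HeightOneSpectrum (𝓞 K)}
    (hv : ((ℓ : ℕ) : 𝓞 K) ∉ v.asIdeal) (hπv : π.1.IsUnramifiedAt v) :
    LocalGlobalCompatibleAt Rec ι π.1 ρ v ↔ SatakeFrobCompatibleAt ι π.1 ρ v :=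
  localGlobalCompatibleAt_iff_satakeFrobCompatibleAt_away hF hn Rec ι π ρ hv hπv

/-- **`GL_n`, every `Rec`, `v ∣ ℓ` with `ρ` and `π` unramified at `v`: the clause IS the Satake clause**
(under `FontaineDatumExists`; c6 assembly `localGlobalCompatibleAt_iff_satakeFrobCompatibleAt_above_of_isUnramifiedAt`).
[cite: FontaineAsterisque223VIII, §2.3.7] [cite: BuzzardGeeLMS2014, Conj. 3.2.1–3.2.2] -/
theorem rankN_localGlobal_iff_satake_above_of_isUnramifiedAt (hF : FontaineDatumExists) {K : Type}
    [Field K] [NumberField K] {ℓ : ℕ} [Fact ℓ.Prime] {n : ℕ} (hn : 1 < n)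
    {hcpt : isCompact_glFiniteIntegralLevel n K} (Rec : ReciprocityData K) (ι : PadicAlgCl ℓ ≃+* ℂ)
    (π : CuspidalAutomorphicRepData n K hcpt) (ρ : FramedGaloisRep K (PadicAlgCl ℓ) n)
    {v : HeightOneSpectrum (𝓞 K)} (hv : ((ℓ : ℕ) : 𝓞 K) ∈ v.asIdeal) (hρ : ρ.IsUnramifiedAt v)
    (hπv : π.1.IsUnramifiedAt v) :
    LocalGlobalCompatibleAt Rec ι π.1 ρ v ↔ SatakeFrobCompatibleAt ι π.1 ρ v :=
  localGlobalCompatibleAt_iff_satakeFrobCompatibleAt_above_of_isUnramifiedAt hF hn Rec ι π ρ hv hρ hπv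


/-! ## 1m. Blocker B2 after the Artin pin (continuation lead c7, wave N7): the `v ∤ ℓ` clause on the
FINITE-INERTIA sector, and rank one at the RAMIFIED places of the Hecke character

c4–c6 settled the clause at every place where `π_v` is unramified (all ranks, every `Rec`).  What is
left of the two LGC stubs is B1 (above `ℓ`, off the `ρ`-unramified sector) and B2: at a place where
`π_v` ramifies, `rec_v` depends on the Artin normalisation of `Rec.llc v`, which the tree's
`LocalArtinData` does not pin on `𝒪_vˣ` — since 2026-08-16 21:36Z the Literature file
`GaloisRepresentations/LocalClassFieldTheory` carries the PIN (`IsLocalArtinMap`, `canonicalArtin`,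
named facts `exists_isLocalArtinMap`, `IsLocalArtinMap.unique`) that the summit's `ReciprocityData` is
to consume as a field `llc_isCanonical` (statement re-type pending).  Wave N7 makes the rank-one content
of the clause at a ramified place EXACT, for every `Rec`, and extends the `v ∤ ℓ` machinery from the
unramified to the finite-inertia ("potentially unramified") sector in every rank:
(S-A) the Grothendieck–Deligne recipe attaches `(ρ|_{W_F}, N = 0)` to every `ρ : Γ_F → GL_n(E)` whose
restriction to `W_F` is continuous for the discrete topology (`WeilGroup.IsContinuousRep`: trivial on an
open subgroup of inertia), granted inertia characters non-trivial on each open subgroup (in the tree: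
`WeilGroup.exists_inertiaCharacter_ne_one`); (S-D) conversely on that sector the recipe returns
`(ρ|_{W_F}, 0)` itself (`N = 0`: `ρ(u₀)` has finite order while `exp(k t(u₀) N) = 1` forces `N = 0`);
(S-C) the rank-one matching at an ARBITRARY place: `N = 0` and `r.ρ = χ ∘ artin` pointwise give the class
`rec₁[χ ∘ det]` (`IsLocalLanglandsGL.rec_one_mk`); (S-F) its converse; (S-E) the local component of a
`GL₁` datum acted on by `θ ∘ det` is `θ_v ∘ det` at EVERY place (uniqueness, not only existence
`hasLocalComponentAt_ofQuasiChar`).  Assembly (lead): at `v ∤ ℓ`, for `π_θ` and `ρ` with finite inertia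
image at `v`, `LocalGlobalCompatibleAt Rec ι π_θ ρ v ↔ ι ∘ ρ|_{W_{K_v}} = θ_v ∘ (Rec.llc v).artin` — the
clause at a ramified place IS the compatibility of `Rec`'s Artin map with class field theory on the pair;
for a canonically normalised `Rec` the right-hand side is Tate's local–global compatibility of the
reciprocity maps (the named residue of B2 in rank one). -/

/- LANDED (c7 wave N7): registered stub `stub_isWeilDeligneOfLadic_ofRep_of_isContinuousRep` — p131937 `Theorems/…ReciprocityUpToIrreducibilityLadicFiniteInertia.lean`
   (imported above, same namespace; open form `isWeilDeligneOfLadic_ofRep_of_isContinuousRep`, helper `toWeilGroupHom_eq_one_of_weilRestrict_eq_one`). -/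

/- LANDED (c7 wave N7): registered stub `stub_eq_ofRep_of_isWeilDeligneOfLadic_of_isContinuousRep` — p132382 `Theorems/…ReciprocityUpToIrreducibilityLadicFiniteInertiaConverse.lean`
   (imported above, same namespace; open form `eq_ofRep_of_isWeilDeligneOfLadic_of_isContinuousRep`, helper `N_eq_zero_of_isWeilDeligneOfLadic_of_forall_eq_one`). -/

/- LANDED (c7 wave N7): registered stub `stub_rankOne_recGL_matching_of_forall` — p132300 `Theorems/…ReciprocityUpToIrreducibilityRankOneMatchingRamified.lean`
   (imported above, same namespace; open forms `eq_ofQuasiCharOn_of_forall`, `hasFrobSemisimpleClass_recGL_one_of_forall`). -/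

/- LANDED (c7 wave N7): registered stub `stub_rankOne_forall_of_hasFrobSemisimpleClass` — p132302 `Theorems/…ReciprocityUpToIrreducibilityRankOneMatchingConverse.lean`
   (imported above, same namespace; open form `N_eq_zero_and_forall_of_hasFrobSemisimpleClass_recGL_one`, helpers `eq_zero_of_isNilpotent_of_finrank_eq_one`, `ρ_eq_smul_id_of_isEquivalent_ofQuasiCharOn`, `ρ_eq_of_isFrobSemisimplificationOf_of_finrank_eq_one`). -/

/- LANDED (c7 wave N7): registered stub `stub_glOne_localComponent_unique` — p132332 `Theorems/…ReciprocityUpToIrreducibilityGLOneLocalComponentUnique.lean`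
   (imported above, same namespace; open forms `quasiChar_det_eq_localComponent_of_hasLocalComponentAt`, `localComponent_ρ_apply_eq_of_hasLocalComponentAt`). -/


/- LANDED (c7 wave N7, lead assembly): registered stub `stub_rankOne_localGlobal_away_iff_artinCompatible` —
   p132954 `Theorems/…ReciprocityUpToIrreducibilityRamifiedPlaces.lean` (imported above, same namespace; open forms
   `localGlobalCompatibleAt_away_iff_of_isContinuousRep` (every rank), `rankOne_localGlobalCompatibleAt_away_of_artinCompatible`,
   `artinCompatible_of_rankOne_localGlobalCompatibleAt_away`, `rankOne_localGlobalCompatibleAt_away_iff_artinCompatible(_of_isOpen_ker)`,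
   `transport_ofRep_rankOne`, `isContinuousRep_weilRestrict(_toLocal)_of_isOpen_ker`). -/

/-- **Every rank, every `Rec`, `v ∤ ℓ`, finite inertia image: the clause is the `ℓ`-blind matching**
(c7; finite-inertia generalisation of `awayUnramified_iff`).  For `ρ` whose restriction to `W_{K_v}` is
trivial on an open subgroup of inertia (e.g. `ρ` of Artin type at `v`),
`LocalGlobalCompatibleAt Rec ι π ρ v ↔ ∃ π_v rℂ, π_v local component ∧ rℂ = ι(ρ|_{W_{K_v}}, 0) ∧ rℂ^{F-ss} ∈ rec_v(π_v)`
— so on that sector both LGC stubs of the line are ONE ℓ-blind statement about `rec_v`, whatever the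
ramification of `π_v`. [cite: DeligneAntwerpII1973, §8.4.2] [cite: TateCorvallis1979, (4.1.3)–(4.2.1)] -/
theorem awayFiniteInertia_iff {K : Type} [Field K] [NumberField K] {ℓ : ℕ} [Fact ℓ.Prime] {n : ℕ}
    {hcpt : isCompact_glFiniteIntegralLevel n K} (Rec : ReciprocityData K) (ι : PadicAlgCl ℓ ≃+* ℂ)
    (π : AutomorphicRepData (AutomorphyDatum.gl n K hcpt)) (ρ : FramedGaloisRep K (PadicAlgCl ℓ) n)
    {v : HeightOneSpectrum (𝓞 K)} (hv : ((ℓ : ℕ) : 𝓞 K) ∉ v.asIdeal)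
    (hc : WeilGroup.IsContinuousRep ((ρ.toLocal v).weilRestrict (v.adicCompletion K))) :
    LocalGlobalCompatibleAt Rec ι π ρ v ↔
      ∃ (πv : SmoothIrrep (GL (Fin n) (v.adicCompletion K)))
        (rℂ : WeilDeligneRep (v.adicCompletion K) ℂ (Fin n → ℂ)),
        π.HasLocalComponentAt v πv.ρ ∧
          (WeilDeligneRep.ofRep ((ρ.toLocal v).weilRestrict (v.adicCompletion K)) hc).IsTransportAlong
            (ι : PadicAlgCl ℓ →+* ℂ) rℂ ∧
          rℂ.HasFrobSemisimpleClass ((Rec.llc v).recGL n (IrrClass.mk πv)) :=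
  localGlobalCompatibleAt_away_iff_of_isContinuousRep Rec ι π ρ hv hc

/-- **Rank one, every `Rec`, ANY place `v ∤ ℓ`: the summit's local–global clause IS the compatibility of
`Rec`'s Artin map at `v` with class field theory on the pair** (c7 assembly; registered stub
`stub_rankOne_localGlobal_away_iff_artinCompatible`, landed p132954).  For `π` acted on through `θ ∘ det`
and `ρ : Γ_K → GL₁(ℚ̄_ℓ)` with open kernel:
`LocalGlobalCompatibleAt Rec ι π ρ v ↔ ∀ w ∈ W_{K_v}, ι(tr ρ|_{Γ_{K_v}}(w)) = θ_v((Rec.llc v).artin w)`.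
At a RAMIFIED place of `θ` this is the exact residue B2 of the line's LGC stubs in rank one.
[cite: HarrisTaylorAMS2001, Thm. A (i)] [cite: TateCorvallis1979, (4.2.1)] -/
theorem rankOne_localGlobal_away_iff_artin {K : Type} [Field K] [NumberField K] {ℓ : ℕ} [Fact ℓ.Prime]
    {hcpt : isCompact_glFiniteIntegralLevel 1 K} (Rec : ReciprocityData K) (ι : PadicAlgCl ℓ ≃+* ℂ)
    (π : AutomorphicRepData (AutomorphyDatum.gl 1 K hcpt)) (θ : HeckeCharacter K)
    (hact : ∀ (g : (AdelicGroupData.gl 1 K).Adelic), ∀ φ ∈ π.W,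
      rightTranslation (AdelicGroupData.gl 1 K) g φ -
        ((θ (Matrix.GeneralLinearGroup.det g) : ℂˣ) : ℂ) • φ ∈ π.W')
    (ρ : FramedGaloisRep K (PadicAlgCl ℓ) 1)
    (hker : IsOpen (ρ.toMonoidHom.ker : Set (Field.absoluteGaloisGroup K))) {v : HeightOneSpectrum (𝓞 K)}
    (hv : ((ℓ : ℕ) : 𝓞 K) ∉ v.asIdeal) :
    LocalGlobalCompatibleAt Rec ι π ρ v ↔
      ∀ w : WeilGroup (v.adicCompletion K),
        (ι : PadicAlgCl ℓ →+* ℂ) ((((ρ.toLocal v).toWeilGroupHom w : GL (Fin 1) (PadicAlgCl ℓ)) :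
            Matrix (Fin 1) (Fin 1) (PadicAlgCl ℓ)).trace) =
          ((θ.localComponent v ((Rec.llc v).artin.artin w) : ℂˣ) : ℂ) :=
  rankOne_localGlobalCompatibleAt_away_iff_artinCompatible_of_isOpen_ker Rec ι π θ hact ρ hker hv

/- LANDED (c7 wave N7, lead assembly): registered stub `stub_automorphicToGalois_glOne_of_artinCompatible` —
   p133189 `Theorems/…ReciprocityUpToIrreducibilityRankOneAllPlaces.lean` (imported above, same namespace; open forms
   `rankOne_corresponds_of_artinCompatible`, `automorphicToGalois_glOne_of_artinCompatible`,
   `galoisToAutomorphic_glOne_of_artinCompatible`, `isOpen_ker_lAdicAvatar`). -/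

/-- **Direction (A) of the summit in rank one at `π_θ`, `θ` finite order unramified ABOVE `ℓ` only, for
EVERY `Rec`, modulo Artin compatibility at the ramified places** (c7; landed p133189).  c4's §1g needed
`θ` unramified EVERYWHERE; the everywhere-hypothesis is now only B1 ("above `ℓ`"), and the price is the
exact B2 residue (CFT_θ): every open-kernel `ρ` with `θ`'s Frobenius data satisfies
`ι(tr ρ(w)) = θ_v((Rec.llc v).artin w)` on `W_{K_v}` at the ramified places of `θ`.
[cite: BuzzardGeeLMS2014, Conj. 3.2.1–3.2.2 (n = 1)] [cite: CasselsFrohlichANT1967, Ch. VII §5.1 Main Theorem] -/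
theorem glOne_automorphicToGalois_of_artinCompatible (hF : FontaineDatumExists) {K : Type} [Field K]
    [NumberField K] {ℓ : ℕ} [Fact ℓ.Prime] {hcpt : isCompact_glFiniteIntegralLevel 1 K}
    (Rec : ReciprocityData K) (ι : PadicAlgCl ℓ ≃+* ℂ)
    {π : AutomorphicRepData (AutomorphyDatum.gl 1 K hcpt)} {θ : HeckeCharacter K}
    (hW : π.W = Submodule.span ℂ {fun g : (AdelicGroupData.gl 1 K).Adelic => (detTwist 1 θ g : ℂ)})
    (hW' : π.W' = ⊥) (hfin : θ.IsFiniteOrder)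
    (hθℓ : ∀ v : HeightOneSpectrum (𝓞 K), ((ℓ : ℕ) : 𝓞 K) ∈ v.asIdeal → θ.IsUnramifiedAt v)
    (hCFT : ∀ ρ : FramedGaloisRep K (PadicAlgCl ℓ) 1,
      IsOpen (ρ.toMonoidHom.ker : Set (Field.absoluteGaloisGroup K)) →
      (∀ v : HeightOneSpectrum (𝓞 K), θ.IsUnramifiedAt v →
        ρ.IsUnramifiedAt v ∧ ρ.HasFrobCharpolyAt v (X - C (ι.symm (θ.valueAtUniformizer v)⁻¹))) →
      ∀ v : HeightOneSpectrum (𝓞 K), ¬ θ.IsUnramifiedAt v →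
        ∀ w : WeilGroup (v.adicCompletion K),
          (ι : PadicAlgCl ℓ →+* ℂ) ((((ρ.toLocal v).toWeilGroupHom w : GL (Fin 1) (PadicAlgCl ℓ)) :
              Matrix (Fin 1) (Fin 1) (PadicAlgCl ℓ)).trace) =
            ((θ.localComponent v ((Rec.llc v).artin.artin w) : ℂˣ) : ℂ)) :
    ∃ ρ : FramedGaloisRep K (PadicAlgCl ℓ) 1,
      ρ.toGaloisRep.IsIrreducible ∧ IsGeometricFramed Rec ρ ∧ Corresponds Rec ι π ρ ∧
        ∀ ρ' : FramedGaloisRep K (PadicAlgCl ℓ) 1, Corresponds Rec ι π ρ' → IsConjugate ρ ρ' :=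
  automorphicToGalois_glOne_of_artinCompatible hF Rec ι hW hW' hfin hθℓ hCFT

/-- **Direction (B) of the summit in rank one at an open-kernel geometric `ρ` unramified above `ℓ`, for
EVERY `Rec`, modulo the mirror hypothesis (CFT_ρ)** (c7; landed p133189).
[cite: FontaineMazurGeometric1995, Conj. 1 (n = 1)] [cite: CasselsFrohlichANT1967, Ch. VII §5.1 Main Theorem] -/
theorem glOne_galoisToAutomorphic_of_artinCompatible (hF : FontaineDatumExists) {K : Type} [Field K]
    [NumberField K] {ℓ : ℕ} [Fact ℓ.Prime] (hcpt : isCompact_glFiniteIntegralLevel 1 K)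
    (Rec : ReciprocityData K) (ι : PadicAlgCl ℓ ≃+* ℂ) (ρ : FramedGaloisRep K (PadicAlgCl ℓ) 1)
    (hker : IsOpen (ρ.toMonoidHom.ker : Set (Field.absoluteGaloisGroup K)))
    (hae : ∀ᶠ v : HeightOneSpectrum (𝓞 K) in cofinite, ρ.IsUnramifiedAt v)
    (hρℓ : ∀ v : HeightOneSpectrum (𝓞 K), ((ℓ : ℕ) : 𝓞 K) ∈ v.asIdeal → ρ.IsUnramifiedAt v)
    (hCFT : ∀ χ : HeckeCharacter K, χ.IsFiniteOrder →
      (∀ v : HeightOneSpectrum (𝓞 K), ρ.IsUnramifiedAt v →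
        χ.IsUnramifiedAt v ∧ ρ.HasFrobCharpolyAt v (X - C (ι.symm (χ.valueAtUniformizer v)⁻¹))) →
      ∀ v : HeightOneSpectrum (𝓞 K), ¬ ρ.IsUnramifiedAt v →
        ∀ w : WeilGroup (v.adicCompletion K),
          (ι : PadicAlgCl ℓ →+* ℂ) ((((ρ.toLocal v).toWeilGroupHom w : GL (Fin 1) (PadicAlgCl ℓ)) :
              Matrix (Fin 1) (Fin 1) (PadicAlgCl ℓ)).trace) =
            ((χ.localComponent v ((Rec.llc v).artin.artin w) : ℂˣ) : ℂ)) :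
    ∃ π : CuspidalAutomorphicRepData 1 K hcpt, π.1.IsLAlgebraic ∧ Corresponds Rec ι π.1 ρ :=
  galoisToAutomorphic_glOne_of_artinCompatible hF hcpt Rec ι ρ hker hae hρℓ hCFT

/- LANDED (c7 wave N7, lead): registered stub `stub_eq_lAdicAvatar_of_hasFrobCharpolyAt` — p134123
   `Theorems/…ReciprocityUpToIrreducibilityArtinLocalGlobal.lean` (imported above, same namespace; open forms
   `artinCompatible_lAdicAvatar`, `conj_eq_self_of_rank_one`, `eq_lAdicAvatar_of_hasFrobCharpolyAt`,
   `automorphicToGalois_glOne_of_isLocalArtinMap`, `galoisToAutomorphic_glOne_of_isLocalArtinMap`), with the named fact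
   RELOCATED by the gate to `Literature/NumberTheory/GaloisRepresentations/ArtinCharacterLocalGlobal.lean` — p134112
   `Literature.NumberTheory.GaloisRepresentations.artinCharacter_localGlobalCompatible` (Neukirch ANT VI Prop. (5.6),
   character form, Deligne normalisation; an unproved named fact, net debt +1). -/

/-- **Both directions of the summit in rank one on the finite-order / open-kernel sector unramified above
`ℓ`, for EVERY `Rec` normalised against THE Artin map, modulo `FontaineDatumExists` and ONE named fact of
class field theory** (c7; landed p134123 + p134112).  For `Rec` whose local Langlands data have Artin maps
with the characterising clauses `IsLocalArtinMap` (the summit's forthcoming field `llc_isCanonical` under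
`exists_isLocalArtinMap`): (A) at `π_θ` (`θ` finite order, unramified above `ℓ`) — an irreducible
pinned-geometric `ρ` with `Corresponds Rec ι π_θ ρ` at EVERY finite place, unique up to conjugacy; (B) at
every open-kernel `ρ` unramified almost everywhere and above `ℓ` — a cuspidal L-algebraic `π` with
`Corresponds Rec ι π ρ`.  This is the whole of `GlobalLanglandsCorrespondenceGLn 1` on that sector; what
it leaves is B1 (`θ` ramified above `ℓ`) and the discharge of the named fact.
[cite: BuzzardGeeLMS2014, Conj. 3.2.1–3.2.2 (n = 1)] [cite: NeukirchANT1999, Ch. VI Prop. (5.6)]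
[cite: FontaineMazurGeometric1995, Conj. 1 (n = 1)] -/
theorem glOne_reciprocity_of_isLocalArtinMap (hF : FontaineDatumExists)
    (hLG : artinCharacter_localGlobalCompatible) {K : Type} [Field K] [NumberField K] {ℓ : ℕ}
    [Fact ℓ.Prime] (hcpt : isCompact_glFiniteIntegralLevel 1 K) (Rec : ReciprocityData K)
    (hRec : ∀ v : HeightOneSpectrum (𝓞 K), IsLocalArtinMap (v.adicCompletion K) (Rec.llc v).artin.artin)
    (ι : PadicAlgCl ℓ ≃+* ℂ) :
    (∀ (π : AutomorphicRepData (AutomorphyDatum.gl 1 K hcpt)) (θ : HeckeCharacter K),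
      π.W = Submodule.span ℂ {fun g : (AdelicGroupData.gl 1 K).Adelic => (detTwist 1 θ g : ℂ)} →
      π.W' = ⊥ → θ.IsFiniteOrder →
      (∀ v : HeightOneSpectrum (𝓞 K), ((ℓ : ℕ) : 𝓞 K) ∈ v.asIdeal → θ.IsUnramifiedAt v) →
      ∃ ρ : FramedGaloisRep K (PadicAlgCl ℓ) 1,
        ρ.toGaloisRep.IsIrreducible ∧ IsGeometricFramed Rec ρ ∧ Corresponds Rec ι π ρ ∧
          ∀ ρ' : FramedGaloisRep K (PadicAlgCl ℓ) 1, Corresponds Rec ι π ρ' → IsConjugate ρ ρ') ∧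
    (∀ ρ : FramedGaloisRep K (PadicAlgCl ℓ) 1,
      IsOpen (ρ.toMonoidHom.ker : Set (Field.absoluteGaloisGroup K)) →
      (∀ᶠ v : HeightOneSpectrum (𝓞 K) in cofinite, ρ.IsUnramifiedAt v) →
      (∀ v : HeightOneSpectrum (𝓞 K), ((ℓ : ℕ) : 𝓞 K) ∈ v.asIdeal → ρ.IsUnramifiedAt v) →
      ∃ π : CuspidalAutomorphicRepData 1 K hcpt, π.1.IsLAlgebraic ∧ Corresponds Rec ι π.1 ρ) :=
  ⟨fun _ _ hW hW' hfin hθℓ => automorphicToGalois_glOne_of_isLocalArtinMap hF hLG Rec hRec ι hW hW' hfin hθℓ,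
    fun ρ hker hae hρℓ => galoisToAutomorphic_glOne_of_isLocalArtinMap hF hLG hcpt Rec hRec ι ρ hker hae hρℓ⟩


/-! ## 1n. The Artin pin's T0 debts (continuation lead c8, wave N8) — ALL LANDED, imported by name

`stub_isLocalArtinMap_unique` (S1) and `stub_exists_isLocalArtinMap` (S2) are the theorems of
`Theorems/…ReciprocityUpToIrreducibilityCanonicalRec.lean` (p136728) over the Literature theorems
`IsLocalArtinMap.unique_holds` (p136353) and `exists_isLocalArtinMap_holds` (p136311); the same file proves
`isLocalArtinMap_of_isCanonical`, `isCanonical_iff_isLocalArtinMap` and the registered glue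
`stub_glOne_reciprocity_of_isCanonical`.  `stub_corresponds_iff_localMatching_of_isOpen_ker` is the theorem of
`…ArtinSector.lean` (p136331).  Nothing of §1n is sorried any more. -/

/-- **§1m for every CANONICALLY NORMALISED reciprocity datum** (c8 glue over wave N8, landed p136728): both
directions of the summit in rank one on the finite-order / open-kernel sector unramified above `ℓ`, for every `Rec`
whose local Langlands data carry THE Artin map, modulo `FontaineDatumExists` and the one class-field-theory fact
`artinCharacter_localGlobalCompatible` (Neukirch VI (5.6)).
[cite: BuzzardGeeLMS2014, Conj. 3.2.1–3.2.2 (n = 1)] [cite: NeukirchANT1999, Ch. VI Prop. (5.6)] -/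
theorem glOne_reciprocity_of_isCanonical (hF : FontaineDatumExists)
    (hLG : artinCharacter_localGlobalCompatible) {K : Type} [Field K] [NumberField K] {ℓ : ℕ}
    [Fact ℓ.Prime] (hcpt : isCompact_glFiniteIntegralLevel 1 K) (Rec : ReciprocityData K)
    (hRec : ∀ v : HeightOneSpectrum (𝓞 K), (Rec.llc v).artin.IsCanonical)
    (ι : PadicAlgCl ℓ ≃+* ℂ) :
    (∀ (π : AutomorphicRepData (AutomorphyDatum.gl 1 K hcpt)) (θ : HeckeCharacter K),
      π.W = Submodule.span ℂ {fun g : (AdelicGroupData.gl 1 K).Adelic => (detTwist 1 θ g : ℂ)} →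
      π.W' = ⊥ → θ.IsFiniteOrder →
      (∀ v : HeightOneSpectrum (𝓞 K), ((ℓ : ℕ) : 𝓞 K) ∈ v.asIdeal → θ.IsUnramifiedAt v) →
      ∃ ρ : FramedGaloisRep K (PadicAlgCl ℓ) 1,
        ρ.toGaloisRep.IsIrreducible ∧ IsGeometricFramed Rec ρ ∧ Corresponds Rec ι π ρ ∧
          ∀ ρ' : FramedGaloisRep K (PadicAlgCl ℓ) 1, Corresponds Rec ι π ρ' → IsConjugate ρ ρ') ∧
    (∀ ρ : FramedGaloisRep K (PadicAlgCl ℓ) 1,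
      IsOpen (ρ.toMonoidHom.ker : Set (Field.absoluteGaloisGroup K)) →
      (∀ᶠ v : HeightOneSpectrum (𝓞 K) in cofinite, ρ.IsUnramifiedAt v) →
      (∀ v : HeightOneSpectrum (𝓞 K), ((ℓ : ℕ) : 𝓞 K) ∈ v.asIdeal → ρ.IsUnramifiedAt v) →
      ∃ π : CuspidalAutomorphicRepData 1 K hcpt, π.1.IsLAlgebraic ∧ Corresponds Rec ι π.1 ρ) :=
  stub_glOne_reciprocity_of_isCanonical hF hLG hcpt Rec hRec ι

/-! ## 1o. Above `ℓ` beyond (F8), relative form (continuation lead c8, wave N9) — ALL LANDED, imported by name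

`stub_localGlobalCompatibleAt_above_iff_of_potentiallyUnramified` (N9-C, `…AbovePotentiallyUnramified.lean`, p136867),
`stub_rankOne_localGlobal_above_iff_artinCompatible` (N9-D, `…RankOneAboveRamified.lean`, p136897),
`stub_glOne_reciprocity_of_isCanonical_of_aboveClause` (`…RankOneFullSector.lean`, p138079),
`stub_corresponds_iff_localMatching_of_aboveClause` (`…ArtinSectorAboveClause.lean`, p137579). -/

/-- **`GlobalLanglandsCorrespondenceGLn 1` on the WHOLE finite-order / Artin sector for every canonical `Rec`**
(landed p138079), modulo `FontaineDatumExists`, Neukirch VI (5.6) and the Weil–Deligne normalisation `hWD` of the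
pinned datum on open-kernel rank-one representations above `ℓ` (what clause D2 would discharge).
[cite: BuzzardGeeLMS2014, Conj. 3.2.1–3.2.2 (n = 1)] [cite: FontaineAsterisque223VIII, §1.3 and §2.3.7] -/
theorem glOne_reciprocity_of_isCanonical_of_aboveClause (hF : FontaineDatumExists)
    (hLG : artinCharacter_localGlobalCompatible) {K : Type} [Field K] [NumberField K] {ℓ : ℕ}
    [Fact ℓ.Prime] (hcpt : isCompact_glFiniteIntegralLevel 1 K) (Rec : ReciprocityData K)
    (hRec : ∀ v : HeightOneSpectrum (𝓞 K), (Rec.llc v).artin.IsCanonical)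
    (hWD : ∀ (v : HeightOneSpectrum (𝓞 K)) (hv : ((ℓ : ℕ) : 𝓞 K) ∈ v.asIdeal)
        (σ : FramedGaloisRep K (PadicAlgCl ℓ) 1)
        (hσ : IsOpen (σ.toMonoidHom.ker : Set (Field.absoluteGaloisGroup K))),
        ∀ r, (Literature.NumberTheory.PAdicHodge.fontainePstAdicCompletion v ℓ hv).IsWeilDeligneOf (σ.toLocal v) r →
          r.IsEquivalent (WeilDeligneRep.ofRep ((σ.toLocal v).weilRestrict (v.adicCompletion K))
            (isContinuousRep_weilRestrict_toLocal_of_isOpen_ker σ hσ v)))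
    (ι : PadicAlgCl ℓ ≃+* ℂ) :
    (∀ (π : AutomorphicRepData (AutomorphyDatum.gl 1 K hcpt)) (θ : HeckeCharacter K),
        π.W = Submodule.span ℂ {fun g : (AdelicGroupData.gl 1 K).Adelic => (detTwist 1 θ g : ℂ)} →
        π.W' = ⊥ → θ.IsFiniteOrder →
        ∃ ρ : FramedGaloisRep K (PadicAlgCl ℓ) 1,
          ρ.toGaloisRep.IsIrreducible ∧ IsGeometricFramed Rec ρ ∧ Corresponds Rec ι π ρ ∧
            ∀ ρ' : FramedGaloisRep K (PadicAlgCl ℓ) 1, Corresponds Rec ι π ρ' → IsConjugate ρ ρ') ∧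
      (∀ ρ : FramedGaloisRep K (PadicAlgCl ℓ) 1,
        IsOpen (ρ.toMonoidHom.ker : Set (Field.absoluteGaloisGroup K)) →
        ∃ π : CuspidalAutomorphicRepData 1 K hcpt, π.1.IsLAlgebraic ∧ Corresponds Rec ι π.1 ρ) :=
  stub_glOne_reciprocity_of_isCanonical_of_aboveClause hF hLG K ℓ hcpt Rec hRec hWD ι

/-! ## 1p. After D1 (continuation lead c8, wave N10) — ALL LANDED, imported by name

`stub_weakExistence_rankOne_normTwist_all` (N10-F, `…WeakExistenceAll.lean`, p138104) and `stub_crux_decides_wd_rankOne`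
(N10-G, `…CruxDecidesWD.lean`, p138410).  Glue: W₁ on the whole sector `χ₀‖·‖^k` with the cyclotomic hypothesis of N10-F
discharged by worker E's unconditional `fontainePstAdicCompletion_isDeRhamFramed_cyclotomic`
(`Literature/NumberTheory/PAdicHodge/FontaineDpstUnconditional.lean`, p137685). -/

/-- **W in rank one on the whole sector `χ₀‖·‖^k` (`χ₀` of finite order with ANY ramification, `k ∈ ℤ`), with NO
named fact**: N10-F with its cyclotomic de Rham hypothesis discharged (D1: the period ring of THE datum is `B_dR(K_v)`
and `ℚ_ℓ(1)` is de Rham for it). [cite: BuzzardGeeLMS2014, Conj. 3.2.2 (case n = 1)]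
[cite: FontaineAsterisque223III, Exp. III §1.5, §3 and Prop. 1.5.2] -/
theorem weakExistence_rankOne_all {K : Type} [Field K] [NumberField K] {ℓ : ℕ} [Fact ℓ.Prime]
    (hcpt : isCompact_glFiniteIntegralLevel 1 K) (π : CuspidalAutomorphicRepData 1 K hcpt)
    (χ₀ : HeckeCharacter K) (k : ℤ)
    (hW : ∀ (g : (AdelicGroupData.gl 1 K).Adelic), ∀ φ ∈ π.1.W,
        rightTranslation (AdelicGroupData.gl 1 K) g φ -
          (((χ₀ * HeckeCharacter.normCharacter K ^ k) (Matrix.GeneralLinearGroup.det g) : ℂˣ) : ℂ) • φ ∈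
            π.1.W')
    (hfin : χ₀.IsFiniteOrder) (ι : PadicAlgCl ℓ ≃+* ℂ) :
    ∃ ρ : FramedGaloisRep K (PadicAlgCl ℓ) 1,
      ((∀ᶠ v : HeightOneSpectrum (𝓞 K) in cofinite, ρ.IsUnramifiedAt v) ∧
        ∀ (v : HeightOneSpectrum (𝓞 K)) (hv : ((ℓ : ℕ) : 𝓞 K) ∈ v.asIdeal),
          (Literature.NumberTheory.PAdicHodge.fontainePstAdicCompletion v ℓ hv).IsDeRhamFramed
            (ρ.toLocal v)) ∧
      ∀ᶠ v : HeightOneSpectrum (𝓞 K) in cofinite, SatakeFrobCompatibleAt ι π.1 ρ v :=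
  stub_weakExistence_rankOne_normTwist_all K ℓ hcpt π χ₀ k hW hfin
    (fun v hv => fontainePstAdicCompletion_isDeRhamFramed_cyclotomic v ℓ hv) ι


/-! ## 1q. Wave N11 (continuation lead c9): W in rank one BEYOND the finite-order sector — every
L-algebraic `π` of `GL₁` over a number field with a real place

After D1 the clause "de Rham at `v ∣ ℓ` for THE datum" is genuine `B_dR`-admissibility, and c8's N10-F
(`weakExistence_rankOne_all`) gives W₁ for every `π` transforming by `(χ₀‖·‖^k) ∘ det`, `χ₀` of finite
order.  Wave N11 removes the model hypothesis: EVERY L-algebraic cuspidal `π` of `GL₁(𝔸_K)` over a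
number field `K` with at least one real place (in particular every totally real `K`, and `K = ℚ`)
transforms by such a character.  Chain (tree dictionary + three registered stubs): `π` has a Hecke
character `θ` (`AutomorphicRepData.exists_heckeCharacter_glOne`); L-algebraic = C-algebraic in odd rank,
so `θ` is algebraic of some infinity type `(p, q)` (`exists_hasInfinityType_heckeCharacter_glOne`, Weil's
type `A₀`); **N11-G** (`stub_infinityType_parallel_of_isReal`): if `K` has a real place then `p_w = q_w` at
every complex place (Weil 1956: purity `n_φ + n_φ̄ = w` for `χ` AND all its `Aut(ℂ)`-conjugates `^σχ` —
the tree's `HasInfinityType.embExponent_autConjType_add_conjugate_eq` — read at a `σ` moving the complex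
embedding to a real one, `exists_ringEquiv_apply_eq`); **N11-B** (`stub_normTwist_hasInfinityType_zero_of_parallel`):
a parallel type is killed by a norm twist, `(θ‖·‖^k)` has type `(0,0)` (purity gives the common value
`k = w/2`; `‖·‖` has type `(-1; 0 resp. -1)`, `isAlgebraic_normCharacter`); **N11-A**
(`stub_isFiniteOrder_of_hasInfinityType_zero`): a Hecke character of type `(0,0)` has finite order
(Neukirch VII (6.9)/(6.14): it is a character of a finite ray class group — `𝔭 ↦ θ(ϖ_𝔭)` is a ray class
character modulo a module of definition, `exists_pos_forall_pow_eq_one_of_isRayClassCharacter`, rigidity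
`eq_one_of_eventually_valueAtUniformizer_eq_one`).  Two further registered stubs record the abelian sector
for EVERY number field: **N11-D** (`stub_rankOne_satakeAE_of_isAlgebraic`, Weil 1956 / Serre 1968 II §2.8 —
the tree's PROVED `HeckeCharacter.IsAlgebraic.exists_lAdic`): every cuspidal `π` of `GL₁` with algebraic
Hecke character has, for all `ℓ, ι`, an `ℓ`-adic character unramified a.e. and Satake–Frobenius compatible
a.e. (W₁ minus the de Rham clause at `v ∣ ℓ`, whose residue over CM fields is the de Rham-ness of
Lubin–Tate characters for `B_dR(K_v)`, absent from the tree); **N11-J**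
(`stub_rankOne_weakAutomorphy_of_isOpen_ker_twist`, the (B)-side twin of N10-F): every rank-one `ρ` of the
form (open kernel) `⊗ ε_ℓ^k` is Satake–Frobenius compatible a.e. with a cuspidal L-algebraic `π` of `GL₁`
(Artin reciprocity for characters, `FramedGaloisRep.exists_heckeCharacter_of_isOpen_ker`, and the
Borel–Jacquet model of `χ‖·‖^{-k}`). -/

/-- **stub N11-A — LANDED** (p140373, `…HeckeTypeZeroFiniteOrder.lean`, imported by name:
`stub_isFiniteOrder_of_hasInfinityType_zero`; Neukirch VII (6.9), (6.14)): a Hecke character with trivial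
infinity type `(0, 0)` has finite order — `𝔭 ↦ χ(ϖ_𝔭)` is a character of the finite ray class group modulo a
module of definition (`isRayClassCharacter_of_isModulus_of_hasInfinityType_zero`), so `χ(ϖ_𝔭)^N = 1` off the
modulus and `χ^N = 1` by rigidity.
[cite: NeukirchANT1999, Ch. VII §6 Prop. (6.9) and Cor. (6.14)] -/
theorem isFiniteOrder_of_hasInfinityType_zero {K : Type} [Field K] [NumberField K] (χ : HeckeCharacter K)
    (h : χ.HasInfinityType 0 0) : χ.IsFiniteOrder :=
  stub_isFiniteOrder_of_hasInfinityType_zero K χ h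

/-- **stub N11-B (Weil 1956 §1; folklore): a PARALLEL infinity type is a norm power up to type `(0,0)`.**
If `χ` has infinity type `(p, q)` with `p_w = q_w` at every complex place `w`, then for some `k ∈ ℤ` the
character `χ · ‖·‖^k` has infinity type `(0, 0)`: purity (`HasInfinityType.exists_two_mul_add_eq_weight_mul_mult`:
`2 (p_w + q_w) = wt [K_w : ℝ]`) makes `wt = 2k` even and `p_w + q_w = k` at real, `p_w = q_w = k` at complex
places; `‖·‖` has infinity type `(-1; 0 at real / -1 at complex)` (proof of `isAlgebraic_normCharacter`), types
add under products (`HasInfinityType.mul'`), and at a real place only `p_w + q_w` matters (`ι_w` is real).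
[cite: Weil1956, §1] [cite: NeukirchANT1999, Ch. VII §6 Prop. (6.9)] -/
theorem stub_normTwist_hasInfinityType_zero_of_parallel :
    ∀ (K : Type) [Field K] [NumberField K] (χ : HeckeCharacter K) (p q : NumberField.InfinitePlace K → ℤ),
      χ.HasInfinityType p q → (∀ w : NumberField.InfinitePlace K, w.IsComplex → p w = q w) →
      ∃ k : ℤ, (χ * HeckeCharacter.normCharacter K ^ k).HasInfinityType 0 0 := by
  sorry

/-- **stub N11-G (Weil 1956 §1: over a field with a real place every algebraic Hecke character has
PARALLEL infinity type).**  If `K` has a real place and `χ` has infinity type `(p, q)`, then `p_w = q_w` at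
every complex place `w`: with `n_φ = embExponent p q φ`, purity holds for `χ` and for every `Aut(ℂ)`-conjugate
`^σχ` with the SAME weight (`HasInfinityType.embExponent_autConjType_add_conjugate_eq`:
`n_{σ⁻¹φ} + n_{σ⁻¹φ̄} = wt` for all `σ : ℂ ≃ₐ[ℚ] ℂ`, `φ`, i.e. `n_ψ + n_{σ⁻¹ conj σ ψ} = wt`); choosing `σ`
with `σ ∘ φ_w` a REAL embedding `φ₀` (`Literature.FieldTheory.AlgClosed.exists_ringEquiv_apply_eq`: `Aut(ℂ)`
is transitive on the embeddings of the countable field `K`), `σ⁻¹ conj σ φ_w = σ⁻¹ conj φ₀ = σ⁻¹ φ₀ = φ_w`,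
so `2 n_{φ_w} = wt`; likewise `2 n_{φ̄_w} = wt`, hence `p_w = n_{φ_w} = n_{φ̄_w} = q_w`.
[cite: Weil1956, §1] [cite: SerreAbelianLadic1968, Ch. II §3.1–3.3] -/
theorem stub_infinityType_parallel_of_isReal :
    ∀ (K : Type) [Field K] [NumberField K], (∃ w₀ : NumberField.InfinitePlace K, w₀.IsReal) →
      ∀ (χ : HeckeCharacter K) (p q : NumberField.InfinitePlace K → ℤ), χ.HasInfinityType p q →
      ∀ w : NumberField.InfinitePlace K, w.IsComplex → p w = q w := by
  sorry

/-- **stub N11-D (Weil 1956; Serre 1968 II §2.8; HLTT Thm. A for `n = 1`): the Satake half of W₁ for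
EVERY algebraic Hecke character over EVERY number field.**  If the cuspidal `π` of `GL₁(𝔸_K)` transforms by
`θ ∘ det` with `θ` algebraic (type `A₀`), then for all `ℓ, ι` there is `ρ : Γ_K → GL₁(ℚ̄_ℓ)` unramified at
almost all places and Satake–Frobenius compatible with `(π, ι)` at almost all places, namely Weil's `ℓ`-adic
character (the tree's PROVED `HeckeCharacter.IsAlgebraic.exists_lAdic`), which moreover is unramified with
`char(Frob_v^{arith}) = X - ι⁻¹(θ(ϖ_v))⁻¹` at every `v ∤ ℓ` where `θ` is unramified (this pins `ρ`).  The de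
Rham clause at `v ∣ ℓ` is NOT asserted (its residue over CM fields = Lubin–Tate characters are de Rham).
[cite: Weil1956, §1–§2] [cite: SerreAbelianLadic1968, Ch. II §2.7–2.8] [cite: BuzzardGeeLMS2014, Conj. 3.2.2 (n = 1)] -/
theorem stub_rankOne_satakeAE_of_isAlgebraic :
    ∀ (K : Type) [Field K] [NumberField K] (ℓ : ℕ) [Fact ℓ.Prime]
      (hcpt : isCompact_glFiniteIntegralLevel 1 K) (π : CuspidalAutomorphicRepData 1 K hcpt)
      (θ : HeckeCharacter K),
      (∀ (g : (AdelicGroupData.gl 1 K).Adelic), ∀ φ ∈ π.1.W,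
        rightTranslation (AdelicGroupData.gl 1 K) g φ -
          ((θ (Matrix.GeneralLinearGroup.det g) : ℂˣ) : ℂ) • φ ∈ π.1.W') →
      θ.IsAlgebraic → ∀ ι : PadicAlgCl ℓ ≃+* ℂ,
        ∃ ρ : FramedGaloisRep K (PadicAlgCl ℓ) 1,
          (∀ v : HeightOneSpectrum (𝓞 K), ((ℓ : ℕ) : 𝓞 K) ∉ v.asIdeal → θ.IsUnramifiedAt v →
            ρ.IsUnramifiedAt v ∧ ρ.HasFrobCharpolyAt v (X - C (ι.symm (θ.valueAtUniformizer v)⁻¹))) ∧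
          (∀ᶠ v : HeightOneSpectrum (𝓞 K) in cofinite, ρ.IsUnramifiedAt v) ∧
          ∀ᶠ v : HeightOneSpectrum (𝓞 K) in cofinite, SatakeFrobCompatibleAt ι π.1 ρ v := by
  sorry

/-- **stub N11-J (the (B)-side twin of N10-F: weak automorphy of `(open kernel) ⊗ ε_ℓ^k` in rank one).**
For `r : Γ_K → GL₁(ℚ̄_ℓ)` with open kernel and `ε = ε_ℓ^k`, the twist `r ⊗ ε` is Satake–Frobenius compatible
at almost all places with a cuspidal L-algebraic `π` of `GL₁(𝔸_K)`: `r` is the avatar of a finite-order Hecke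
character `χ` (`FramedGaloisRep.exists_heckeCharacter_of_isOpen_ker`, Artin reciprocity), `π = ℂ·((χ‖·‖^{-k}) ∘ det)/⊥`
(Borel–Jacquet model, `exists_cuspidal_detTwist_glOne`; L-algebraic because `χ‖·‖^{-k}` is algebraic:
`AutomorphicRepData.exists_hasInfinityType_of_hasInfinityType_heckeCharacter_glOne`), and the Frobenius
bookkeeping of N10-F (`hasFrobCharpolyAt_twist_of_eq_prod`, `coe_apply_of_isArithFrobAt_of_cyclotomic_zpow`,
`valueAtUniformizer_normCharacter`). [cite: FontaineMazurGeometric1995, Conj. 1 (n = 1)]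
[cite: SerreAbelianLadic1968, Ch. I §1.2 and Ch. III §2.3] -/
theorem stub_rankOne_weakAutomorphy_of_isOpen_ker_twist :
    ∀ (K : Type) [Field K] [NumberField K] (ℓ : ℕ) [Fact ℓ.Prime]
      (hcpt : isCompact_glFiniteIntegralLevel 1 K) (ι : PadicAlgCl ℓ ≃+* ℂ)
      (r : FramedGaloisRep K (PadicAlgCl ℓ) 1),
      IsOpen (r.toMonoidHom.ker : Set (Field.absoluteGaloisGroup K)) →
      ∀ (k : ℤ) (ε : Field.absoluteGaloisGroup K →ₜ* (PadicAlgCl ℓ)ˣ),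
        (∀ σ, (ε σ : PadicAlgCl ℓ) =
          (algebraMap ℚ_[ℓ] (PadicAlgCl ℓ) ((GaloisRep.cyclotomicCharacter K ℓ σ : ℤ_[ℓ]ˣ) : ℤ_[ℓ])) ^ k) →
        ∃ π : CuspidalAutomorphicRepData 1 K hcpt, π.1.IsLAlgebraic ∧
          ∀ᶠ v : HeightOneSpectrum (𝓞 K) in cofinite, SatakeFrobCompatibleAt ι π.1 (r.twist ε) v := by
  sorry

/-- **Assembly of wave N11 (lead c9): W — weak existence, Buzzard–Gee Conj. 3.2.2 weak form — in rank one
for EVERY L-algebraic cuspidal `π` over every number field with a real place** (totally real fields, `ℚ`, every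
field of odd degree, …): for all `ℓ, ι` some `ρ : Γ_K → GL₁(ℚ̄_ℓ)` unramified a.e., de Rham at every `v ∣ ℓ`
for THE datum, Satake–Frobenius compatible a.e. — `stub_weakExistence` at `n = 1` on that sector, with NO model
hypothesis and NO named fact.  From N11-G, N11-B, N11-A and c8's `weakExistence_rankOne_all`.
[cite: BuzzardGeeLMS2014, Conj. 3.2.2 (n = 1)] [cite: Weil1956, §1–§2] -/
theorem weakExistence_rankOne_of_isReal_of_stubs {K : Type} [Field K] [NumberField K]
    (hK : ∃ w₀ : NumberField.InfinitePlace K, w₀.IsReal) {ℓ : ℕ} [Fact ℓ.Prime]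
    (hcpt : isCompact_glFiniteIntegralLevel 1 K) (π : CuspidalAutomorphicRepData 1 K hcpt)
    (hL : π.1.IsLAlgebraic) (ι : PadicAlgCl ℓ ≃+* ℂ) :
    ∃ ρ : FramedGaloisRep K (PadicAlgCl ℓ) 1,
      ((∀ᶠ v : HeightOneSpectrum (𝓞 K) in cofinite, ρ.IsUnramifiedAt v) ∧
        ∀ (v : HeightOneSpectrum (𝓞 K)) (hv : ((ℓ : ℕ) : 𝓞 K) ∈ v.asIdeal),
          (Literature.NumberTheory.PAdicHodge.fontainePstAdicCompletion v ℓ hv).IsDeRhamFramed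
            (ρ.toLocal v)) ∧
      ∀ᶠ v : HeightOneSpectrum (𝓞 K) in cofinite, SatakeFrobCompatibleAt ι π.1 ρ v := by
  obtain ⟨θ, hθ⟩ := π.1.exists_heckeCharacter_glOne
  obtain ⟨T, hT, hTC⟩ := hL.isCAlgebraic_of_odd odd_one
  obtain ⟨p, q, hinf⟩ := π.1.exists_hasInfinityType_heckeCharacter_glOne hθ hT hTC
  have hpar := stub_infinityType_parallel_of_isReal K hK θ p q hinf
  obtain ⟨k, h0⟩ := stub_normTwist_hasInfinityType_zero_of_parallel K θ p q hinf hpar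
  have hfin : (θ * HeckeCharacter.normCharacter K ^ k).IsFiniteOrder :=
    stub_isFiniteOrder_of_hasInfinityType_zero K _ h0
  have heq : θ * HeckeCharacter.normCharacter K ^ k * HeckeCharacter.normCharacter K ^ (-k) = θ := by
    rw [mul_assoc, ← zpow_add, add_neg_cancel, zpow_zero, mul_one]
  refine weakExistence_rankOne_all hcpt π (θ * HeckeCharacter.normCharacter K ^ k) (-k) ?_ hfin ι
  intro g φ hφ
  rw [heq]
  exact hθ g φ hφ

/-- **Corollary: W₁ for every L-algebraic cuspidal `π` of `GL₁` over a TOTALLY REAL field** (every infinite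
place is real). [cite: BuzzardGeeLMS2014, Conj. 3.2.2 (n = 1)] -/
theorem weakExistence_rankOne_of_isTotallyReal_of_stubs {K : Type} [Field K] [NumberField K]
    [NumberField.IsTotallyReal K] {ℓ : ℕ} [Fact ℓ.Prime]
    (hcpt : isCompact_glFiniteIntegralLevel 1 K) (π : CuspidalAutomorphicRepData 1 K hcpt)
    (hL : π.1.IsLAlgebraic) (ι : PadicAlgCl ℓ ≃+* ℂ) :
    ∃ ρ : FramedGaloisRep K (PadicAlgCl ℓ) 1,
      ((∀ᶠ v : HeightOneSpectrum (𝓞 K) in cofinite, ρ.IsUnramifiedAt v) ∧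
        ∀ (v : HeightOneSpectrum (𝓞 K)) (hv : ((ℓ : ℕ) : 𝓞 K) ∈ v.asIdeal),
          (Literature.NumberTheory.PAdicHodge.fontainePstAdicCompletion v ℓ hv).IsDeRhamFramed
            (ρ.toLocal v)) ∧
      ∀ᶠ v : HeightOneSpectrum (𝓞 K) in cofinite, SatakeFrobCompatibleAt ι π.1 ρ v := by
  obtain ⟨w₀⟩ := (inferInstance : Nonempty (NumberField.InfinitePlace K))
  exact weakExistence_rankOne_of_isReal_of_stubs ⟨w₀, NumberField.IsTotallyReal.isReal w₀⟩ hcpt π hL ι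


/-! ## 1r. Wave N12 (continuation lead c9): direction (B) in rank one on the `E`-RATIONAL sector, and
the exact rank-one residue of lang.S03 / B_w

Böckle–Hui's Theorem 1.1 is PROVED in the tree (`exists_heckeCharacter_of_weaklyDivides_holds`): an
`E`-rational rank-one `ℓ`-adic `ρ` (BH §2.1, `FramedGaloisRep.IsRationalOver`; unramified a.e. with
Frobenius polynomials over one number field `E`) is the avatar of an ALGEBRAIC Hecke character `χ`
(`ρ(Frob_v) = ι⁻¹(χ(ϖ_v))⁻¹` a.e.; semisimplicity and "weakly divides itself" are free in rank one,
`isSemisimple_toGaloisRep_of_rank_one`, `weaklyDivides_self_of_eventually_isUnramifiedAt`).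
**N12-R** (`stub_rankOne_weakAutomorphy_of_isRationalOver`): hence B_w (weak automorphy, the
conclusion of lang.S03) holds in rank one for EVERY `E`-rational `ρ` over EVERY number field —
`π = π_χ = ℂ·(χ ∘ det)/⊥` (Borel–Jacquet), cuspidal, L-algebraic because `χ` is algebraic, Satake
parameter `{χ(ϖ_v)}` a.e.  **N12-V** (`stub_rankOne_isRationalOver_of_heckeAvatar`, Weil 1956: the values
of an algebraic Hecke character off its ramification lie in ONE number field,
`IsAlgebraic.exists_intermediateField_eventually_valueAtUniformizer_mem`): conversely every Hecke
avatar is `E`-rational.  So in rank one {`E`-rational} = {avatars of algebraic Hecke characters} ⊇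
{the `ρ` attached to L-algebraic `π` by N11-D}; W₁ (Satake half) and B_w₁ hold on that sector
unconditionally; and (lead assembly `…RankOneRationalSector.lean`) **B_w at `n = 1` over `K` is
EQUIVALENT to "every pinned-geometric rank-one `ρ` over `K` is `E`-rational"** — Fontaine–Mazur
rationality in rank one (de Rham ⇒ Hodge–Tate ⇒ locally algebraic: Tate–Sen; Serre 1968 Ch. III
§1.2 Thm. 2, §2.3), which is therefore the exact residue of `stub_fontaineMazurLanglandsGLn` /
`weakAutomorphy_of_stubs` in rank one. -/

/-- **stub N12-R (B_w in rank one on the `E`-rational sector; Böckle–Hui Thm. 1.1 + Borel–Jacquet).**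
For every number field `K`, prime `ℓ`, `ι : ℚ̄_ℓ ≃ ℂ`, number field `E` with `e : E → ℚ̄_ℓ`, and every
`E`-rational `ρ : Γ_K → GL₁(ℚ̄_ℓ)` (`FramedGaloisRep.IsRationalOver e ρ`), there is a cuspidal
L-algebraic `π` of `GL₁(𝔸_K)` Satake–Frobenius compatible with `(ρ, ι)` at almost all places: by the
tree's PROVED `exists_heckeCharacter_of_weaklyDivides_holds` (with `ρ` weakly dividing itself,
semisimple of rank one) `ρ` is the avatar of an algebraic Hecke character `χ`
(`ρ(Frob_v) = ι⁻¹(χ(ϖ_v))⁻¹` a.e.), and `π = π_χ` (`exists_cuspidal_detTwist_glOne`; L-algebraic since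
`χ` is algebraic; Satake parameter `{χ(ϖ_v)}` off the ramification, `arithFrobPolyOfSatake_one`).
[cite: BockleHui2025, Theorem 1.1 and §3.2.1] [cite: BorelJacquet1979, 4.6]
[cite: FontaineMazurGeometric1995, Conj. 1 (n = 1)] -/
theorem stub_rankOne_weakAutomorphy_of_isRationalOver :
    ∀ (K : Type) [Field K] [NumberField K] (ℓ : ℕ) [Fact ℓ.Prime]
      (hcpt : isCompact_glFiniteIntegralLevel 1 K) (ι : PadicAlgCl ℓ ≃+* ℂ)
      (E : Type) [Field E] [NumberField E] (e : E →+* PadicAlgCl ℓ)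
      (ρ : FramedGaloisRep K (PadicAlgCl ℓ) 1), ρ.IsRationalOver e →
        ∃ π : CuspidalAutomorphicRepData 1 K hcpt, π.1.IsLAlgebraic ∧
          ∀ᶠ v : HeightOneSpectrum (𝓞 K) in cofinite, SatakeFrobCompatibleAt ι π.1 ρ v := by
  sorry

/-- **stub N12-V (Weil 1956: Hecke avatars are `E`-rational).**  If `ρ : Γ_K → GL₁(ℚ̄_ℓ)` is, at
almost all places, unramified with arithmetic-Frobenius polynomial `X - ι⁻¹(χ(ϖ_v))⁻¹` for an ALGEBRAIC
Hecke character `χ`, then `ρ` is `E`-rational (`FramedGaloisRep.IsRationalOver`) for the number field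
`E ⊆ ℂ` generated by the values of `χ` (`IsAlgebraic.exists_intermediateField_eventually_valueAtUniformizer_mem`),
embedded into `ℚ̄_ℓ` by `ι⁻¹`: `X - ι⁻¹(χ(ϖ_v))⁻¹ = (X - (χ(ϖ_v))⁻¹).map (ι⁻¹|_E)`.
[cite: Weil1956, §1] [cite: BockleHui2025, §2.1] -/
theorem stub_rankOne_isRationalOver_of_heckeAvatar :
    ∀ (K : Type) [Field K] [NumberField K] (ℓ : ℕ) [Fact ℓ.Prime] (ι : PadicAlgCl ℓ ≃+* ℂ)
      (ρ : FramedGaloisRep K (PadicAlgCl ℓ) 1) (χ : HeckeCharacter K), χ.IsAlgebraic →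
      (∀ᶠ v : HeightOneSpectrum (𝓞 K) in cofinite, ρ.IsUnramifiedAt v ∧
          ρ.HasFrobCharpolyAt v (X - C (ι.symm (χ.valueAtUniformizer v)⁻¹))) →
      ∃ E : IntermediateField ℚ ℂ, FiniteDimensional ℚ E ∧
        ρ.IsRationalOver ((ι.symm : ℂ ≃+* PadicAlgCl ℓ).toRingHom.comp (algebraMap E ℂ)) := by
  sorry

/-- **Glue of wave N12: every avatar of an ALGEBRAIC Hecke character is weakly automorphic** (N12-V:
it is `E`-rational; N12-R: `E`-rational rank-one representations are weakly automorphic).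
[cite: BockleHui2025, Theorem 1.1 and §3.2.1] [cite: Weil1956, §1] -/
theorem rankOne_weakAutomorphy_of_heckeAvatar_of_stubs {K : Type} [Field K] [NumberField K]
    {ℓ : ℕ} [Fact ℓ.Prime] (hcpt : isCompact_glFiniteIntegralLevel 1 K) (ι : PadicAlgCl ℓ ≃+* ℂ)
    (ρ : FramedGaloisRep K (PadicAlgCl ℓ) 1) {χ : HeckeCharacter K} (hχ : χ.IsAlgebraic)
    (h : ∀ᶠ v : HeightOneSpectrum (𝓞 K) in cofinite, ρ.IsUnramifiedAt v ∧
        ρ.HasFrobCharpolyAt v (X - C (ι.symm (χ.valueAtUniformizer v)⁻¹))) :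
    ∃ π : CuspidalAutomorphicRepData 1 K hcpt, π.1.IsLAlgebraic ∧
      ∀ᶠ v : HeightOneSpectrum (𝓞 K) in cofinite, SatakeFrobCompatibleAt ι π.1 ρ v := by
  obtain ⟨E, hfd, hrat⟩ := stub_rankOne_isRationalOver_of_heckeAvatar K ℓ ι ρ χ hχ h
  haveI : FiniteDimensional ℚ E := hfd
  haveI : NumberField E := NumberField.mk
  exact stub_rankOne_weakAutomorphy_of_isRationalOver K ℓ hcpt ι E _ ρ hrat


/-! ## 2. One prime suffices (card `one-prime-companions`) -/

/-- **Companions (compatible-system rigidity, Frobenius-polynomial form):** a geometric `ℓ`-adic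
representation has, for every other prime `ℓ'` and every pair of complex transports, a geometric
`ℓ'`-adic partner with the same complex Frobenius polynomials almost everywhere.  Known only via
potential automorphy (BLGGT arXiv:1010.2561 Thm 5.4.1: regular, odd, polarizable, TR/CM). -/
def Companions : Prop :=
  ∀ (K : Type) [Field K] [NumberField K] (n : ℕ) (ℓ ℓ' : ℕ) [Fact ℓ.Prime] [Fact ℓ'.Prime]
    (ι : PadicAlgCl ℓ ≃+* ℂ) (ι' : PadicAlgCl ℓ' ≃+* ℂ) (ρ : FramedGaloisRep K (PadicAlgCl ℓ) n),
    IsGeometricPinned ρ →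
      ∃ ρ' : FramedGaloisRep K (PadicAlgCl ℓ') n, IsGeometricPinned ρ' ∧
        ∀ᶠ v : HeightOneSpectrum (𝓞 K) in cofinite, ρ.IsUnramifiedAt v ∧ ρ'.IsUnramifiedAt v ∧
          ∃ P : Polynomial ℂ, ρ.HasFrobCharpolyAt v (P.map (ι.symm : ℂ →+* PadicAlgCl ℓ)) ∧
            ρ'.HasFrobCharpolyAt v (P.map (ι'.symm : ℂ →+* PadicAlgCl ℓ'))

/-- **A_∃ — existence at ONE prime of our choosing** (per `π`). -/
def ExistenceAtOnePrime : Prop :=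
  ∀ (K : Type) [Field K] [NumberField K] (n : ℕ) (hcpt : isCompact_glFiniteIntegralLevel n K),
    0 < n → ∀ π : CuspidalAutomorphicRepData n K hcpt, π.1.IsLAlgebraic →
      ∃ (ℓ : ℕ) (_ : Fact ℓ.Prime) (ι : PadicAlgCl ℓ ≃+* ℂ) (ρ : FramedGaloisRep K (PadicAlgCl ℓ) n),
        IsGeometricPinned ρ ∧
          ∀ᶠ v : HeightOneSpectrum (𝓞 K) in cofinite, SatakeFrobCompatibleAt ι π.1 ρ v

/-- **B_∃ — automorphy of a companion at ONE prime of our choosing** (per `ρ`): the natural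
output of every automorphy-lifting engine, run at a large / adequate / Fontaine–Laffaille prime of
the compatible system through `ρ` (irreducibility of the companion is Companions' business: Deligne's
conjecture includes it).  The level witness is the proved `isCompact_glFiniteIntegralLevel_holds`
(any two witnesses are definitionally equal). -/
def AutomorphyAtOnePrime : Prop :=
  ∀ (K : Type) [Field K] [NumberField K] (n : ℕ) (ℓ : ℕ) [Fact ℓ.Prime] (ι : PadicAlgCl ℓ ≃+* ℂ)
    (ρ : FramedGaloisRep K (PadicAlgCl ℓ) n), 0 < n → ρ.toGaloisRep.IsIrreducible →
      IsGeometricPinned ρ →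
      ∃ (ℓ₁ : ℕ) (_ : Fact ℓ₁.Prime) (ι₁ : PadicAlgCl ℓ₁ ≃+* ℂ) (r : FramedGaloisRep K (PadicAlgCl ℓ₁) n)
        (σ : CuspidalAutomorphicRepData n K (isCompact_glFiniteIntegralLevel_holds n K)),
        σ.1.IsLAlgebraic ∧
        (∀ᶠ v : HeightOneSpectrum (𝓞 K) in cofinite, SatakeFrobCompatibleAt ι₁ σ.1 r v) ∧
        ∀ᶠ v : HeightOneSpectrum (𝓞 K) in cofinite, ρ.IsUnramifiedAt v ∧
          ∃ P : Polynomial ℂ, ρ.HasFrobCharpolyAt v (P.map (ι.symm : ℂ →+* PadicAlgCl ℓ)) ∧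
            r.HasFrobCharpolyAt v (P.map (ι₁.symm : ℂ →+* PadicAlgCl ℓ₁))

/-- The complex Satake polynomial `∏_{a ∈ α} (X - a⁻¹)` whose `ι⁻¹`-transport is
`arithFrobPolyOfSatake ι q 1 α`. -/
def satakePolyC (α : Multiset ℂ) : Polynomial ℂ := (α.map fun a => X - C a⁻¹).prod

theorem arithFrobPolyOfSatake_one_eq_map {ℓ : ℕ} [Fact ℓ.Prime] (ι : PadicAlgCl ℓ ≃+* ℂ)
    (q : ℕ) (α : Multiset ℂ) :
    arithFrobPolyOfSatake ι q 1 α = (satakePolyC α).map (ι.symm : ℂ →+* PadicAlgCl ℓ) := by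
  rw [arithFrobPolyOfSatake_one, satakePolyC, Polynomial.map_multiset_prod, Multiset.map_map]
  congr 1
  refine Multiset.map_congr rfl fun a _ => ?_
  simp [Polynomial.map_sub, Polynomial.map_X, Polynomial.map_C]

/-- Transport of a Frobenius polynomial through two complex structures. -/
theorem eq_satakePolyC_of_hasFrobCharpolyAt {K : Type} [Field K] [NumberField K] {ℓ : ℕ}
    [Fact ℓ.Prime] (ι : PadicAlgCl ℓ ≃+* ℂ) {n : ℕ} {ρ : FramedGaloisRep K (PadicAlgCl ℓ) n}
    {v : HeightOneSpectrum (𝓞 K)} {α : Multiset ℂ} {P : Polynomial ℂ}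
    (hα : ρ.HasFrobCharpolyAt v (arithFrobPolyOfSatake ι v.residueCard 1 α))
    (hP : ρ.HasFrobCharpolyAt v (P.map (ι.symm : ℂ →+* PadicAlgCl ℓ))) : P = satakePolyC α := by
  have h1 : P.map (ι.symm : ℂ →+* PadicAlgCl ℓ) = arithFrobPolyOfSatake ι v.residueCard 1 α :=
    GaloisRep.HasFrobCharpolyAt.unique_holds
      ((FramedGaloisRep.hasFrobCharpolyAt_toGaloisRep_iff v _ ρ).mpr hP)
      ((FramedGaloisRep.hasFrobCharpolyAt_toGaloisRep_iff v _ ρ).mpr hα)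
  rw [arithFrobPolyOfSatake_one_eq_map] at h1
  exact Polynomial.map_injective _ ι.symm.injective h1

/-- **First lemma of card 2 (ℓ-transport), PROVED:** one prime per object + companions ⇒ all
primes, for both weak directions. -/
theorem weak_of_onePrime (hComp : Companions) (hA : ExistenceAtOnePrime)
    (hB : AutomorphyAtOnePrime) : WeakExistence ∧ WeakAutomorphy := by
  constructor
  · intro K _ _ n hcpt hn π hL ℓ _ ι
    obtain ⟨ℓ₀, inst₀, ι₀, ρ₀, hgeo₀, hρ₀⟩ := hA K n hcpt hn π hL
    obtain ⟨ρ', hgeo', hev⟩ := hComp K n ℓ₀ ℓ ι₀ ι ρ₀ hgeo₀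
    refine ⟨ρ', hgeo', ?_⟩
    filter_upwards [hρ₀, hev] with v hv hv'
    obtain ⟨α, hα, -, hcp₀⟩ := hv
    obtain ⟨-, hur', P, hP₀, hP'⟩ := hv'
    obtain rfl : P = satakePolyC α := eq_satakePolyC_of_hasFrobCharpolyAt ι₀ hcp₀ hP₀
    refine ⟨α, hα, hur', ?_⟩
    rwa [arithFrobPolyOfSatake_one_eq_map]
  · intro K _ _ n hcpt hn ℓ _ ι ρ hirr hgeo
    obtain ⟨ℓ₁, inst₁, ι₁, r, σ, hL, hσr, hev⟩ := hB K n ℓ ι ρ hn hirr hgeo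
    refine ⟨σ, hL, ?_⟩
    filter_upwards [hσr, hev] with v hv hv'
    obtain ⟨α, hα, -, hcpr⟩ := hv
    obtain ⟨hurρ, P, hPρ, hPr⟩ := hv'
    obtain rfl : P = satakePolyC α := eq_satakePolyC_of_hasFrobCharpolyAt ι₁ hcpr hPr
    refine ⟨α, hα, hurρ, ?_⟩
    rwa [arithFrobPolyOfSatake_one_eq_map]

end Summit.Langlands.Langlands.Theorems.ReciprocityUpToIrreducibility

end
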